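import Literature.NumberTheory.EllipticCurves.PastenValuationProductThm75AsymptoticProofs
import Literature.NumberTheory.EllipticCurves.NewformsStrongMultiplicityOneProofs
import Literature.NumberTheory.EllipticCurves.NewformsRealCoefficients
import Literature.NumberTheory.EllipticCurves.ModularFormsGamma0Genus
import Literature.NumberTheory.EllipticCurves.ModularCurveSturmProofs
import Literature.NumberTheory.Sieve.DivisorBound
import Mathlib.NumberTheory.ArithmeticFunction.Moebius
import HarnessLib

/-!
# Counting systems of Hecke eigenvalues on `S_k(Γ₀(N))` (Pasten, *Shimura curves and the abc
# conjecture*, §7.1 / Prop. 7.1: the quantity `r_{1,N}`), and Thm 7.5 (asymptotic clause) from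
# modularity and Murty's Lemma 11

Topic `NumberTheory/EllipticCurves`; namespaces `Literature.NumberTheory.EllipticCurves.ModularForms`
(Parts A–D) and `Literature.NumberTheory.EllipticCurves` (Part E, as the siblings
`PastenValuationProductThm75*Proofs.lean`). A proofs-only companion (theorems only: NO definition,
NO new named fact, nothing restated; D-0026) of the named fact `pasten_thm_7_5` of
`PastenValuationProduct.lean` — *"Let `ε > 0`. For all elliptic curves `E/ℚ` of conductor
`N ≫_ε 1`, `log|Δ_E| < (1/4 + ε) N log N`"* (H. Pasten, J. Number Theory 254 (2024) =
arXiv:1705.09251, Thm 7.5, p. 27) — continuing `PastenValuationProductThm75AsymptoticProofs.lean`.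

## What this file does

After the sibling, `pasten_thm_7_5` followed (`pasten_thm_7_5_of_modularity_of_thm_5_5`) from four
named facts of the tree (modularity, Mazur–Kenku, Thm 5.5, Deligne's bound) and two un-vendored
printed inputs of the asymptotic clause of Thm 7.2: Murty's Lemma 11 (`hMurty`) and **Prop. 7.1**
(`hr`), the bound on the number `r_{1,N} = Σ_c #c` of systems of Hecke eigenvalues on `𝕋_{1,N}`
counted with the degrees `#c` of their classes (Pasten 2024, §7.1 p. 26: "let `r_{D,M}` be the
number of systems of Hecke eigenvalues on `𝕋_{D,M}` … By multiplicity one in `S₂(n)^{new}` and by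
the Jacquet–Langlands correspondence we have `r_{D,M} = Σ_{m ∣ M} s(Dm)`", `s(n) = dim S₂(n)^{new}`,
whence by G. Martin's dimension bound "`r_{D,M} < (1/12 + ε) φ(D) M` for `N ≫_ε 1`"; and p. 26,
proof of Thm 7.2: "Here we used the fact that `r_{D,M} = Σ_c #c`"). **This file proves that input
over the tree** — so that Prop 7.1 is no longer a hypothesis — and re-assembles Thm 7.5:
`pasten_thm_7_5_of_modularity_of_murtyLemma : modularity → Mazur–Kenku → Thm 5.5 → Deligne →
Murty's Lemma 11 → pasten_thm_7_5`.

In the tree's vocabulary (`PastenSpectralDegree.lean`) the classes `c` are the minimal primes `P` of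
`𝕋 = anemicHeckeRing N k = ℤ[T_p : p ∤ N]` and `#c = rank_ℤ(𝕋 ⧸ P)`. For every level `N ≥ 1` and
weight `k`:

  `Σ_{P minimal} rank_ℤ(𝕋 ⧸ P) ≤ rank_ℤ 𝕋 ≤ #{systems of eigenvalues} ≤ Σ_{M ∣ N} #newforms0(M)
     = Σ_{ab = N} μ(a) · dim_ℂ S_k(Γ₀(b))`                (`sum_finrank_quotient_minimalPrimes_le_moebius_sum`)

i.e. `r_{1,N} ≤ Σ_{m ∣ N} s(m)` with the right-hand side rewritten through the dimensions of the
full spaces by Möbius inversion of the Atkin–Lehner count `dim S_k(Γ₀(L)) = Σ_{M ∣ L} s(M) d(L/M)`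
(this replaces "multiplicity one in `S₂(n)^{new}`" — only the inequality is needed — and G. Martin's
closed form for `s(m)`); and, in weight `2`, by the genus formula,

  `12 Σ_{ab = N} μ(a) dim S₂(Γ₀(b)) = Σ_{ab = N} μ(a) (12 + ψ(b) − 3ν₂(b) − 4ν₃(b) − 6ν_∞(b))
     ≤ N + 25 d(N)³ √N`,                                  (`twelve_mul_moebius_sum_finrank_cuspForm_two_le`)

(`(μ ⋆ ψ)(N) = N ∏_{p² ∣ N}(1 − p⁻²) ≤ N`; `ν₂ ≤ 2^ω ≤ d`, `ν₃ ≤ 3^ω ≤ d²`, `ν_∞ ≤ d√N` on the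
divisors), whence `Σ_c #c ≤ (1/12 + ε) N` for `N ≫_ε 1` by `d(N) ≪ N^{1/12}`
(`exists_sum_finrank_quotient_minimalPrimes_two_le`) — Prop 7.1 in the asymptotic form the proof
of Thm 7.2 uses (Pasten's explicit `N/12 + (7/12) d(N²) + 1` is sharper and not needed). All
inputs are theorems of the tree: the Atkin–Lehner basis of `S_k(Γ₀(L))`
(`linearIndependent_degeneracyMap0_newforms`, `iSup_atkinLehnerComponent_eq_top`,
`span_newforms0_holds`; Atkin–Lehner 1970, Thm. 5), the reality of Hecke eigenvalues
(`conj_eq_of_heckeT_eq_smul`; Diamond–Shurman Thm. 5.5.3), Shimura's Hecke-stable lattice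
(`exists_heckeStable_realBasis`; Shimura 1971, Thm. 3.48), the dimension formula
`dim S₂(Γ₀(N)) = g(X₀(N))` and the genus formula (`finrank_cuspForm_two_eq_genusX0_holds`,
`twelve_mul_genusX0_holds`; Diamond–Shurman Thm. 3.1.1, 3.5.1), and the divisor bound
(`Sieve.exists_card_divisors_le_mul_rpow'`).

## Contents (all proved)

* Part A `sum_finrank_quotient_le_finrank_of_pairwise_not_le` (commutative algebra): for a ring `R`
  finite over `ℤ` and pairwise incomparable primes `P` with `R ⧸ P` free,
  `Σ_P rank_ℤ(R ⧸ P) ≤ rank_ℤ R`; `sum_finrank_quotient_minimalPrimes_le_finrank` for `𝕋`.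
* Part B `finrank_anemicHeckeRing_le_card_systems`: **`rank_ℤ 𝕋 ≤ #{distinct systems χ_i}`** for
  any eigenbasis `v_i` of `S_k(Γ₀(N))` (integer matrices of a `ℤ`-basis of `𝕋` in Shimura's
  lattice basis are `ℚ`-free; the systems are real, `conj_anemicEigenvalue`; rational functionals
  `ℝ → ℚ` turn a real relation among the integer matrices into a rational one).
* Part C: the Atkin–Lehner eigenbasis (`span_degeneracyMap0_newforms_eq_top`,
  `isAnemicEigenvector_degeneracyMap0_newforms`, `anemicEigenvalue_degeneracyMap0_newforms_eq`),
  the count `dim S_k(Γ₀(L)) = Σ_{M ∣ L} #newforms0(M) d(L/M)`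
  (`finrank_cuspForm_eq_sum_divisors_card_newforms0`), Möbius inversion
  (`sum_divisors_card_newforms0_eq_moebius_sum`) and `sum_finrank_quotient_minimalPrimes_le_moebius_sum`.
* Part D (weight 2): `moebius_mul_gamma0Index_le`; root counts
  `natCard_sq_add_one_zmod_prime_pow_le`, `natCard_sq_add_self_add_one_zmod_prime_pow_le`,
  `natCard_aeval_eq_zero_zmod_mul` (CRT), `nu₂_le_card_divisors`, `nu₃_le_card_divisors_sq` (with `2^ω ≤ d`
  inlined; cf. `SquarefulCount.two_pow_card_primeFactors_le_card_divisors`),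
  `nuInfty_le_card_divisors_mul_sqrt`; `twelve_mul_moebius_sum_finrank_cuspForm_two_le`,
  `exists_moebius_sum_finrank_cuspForm_two_le`, `exists_sum_finrank_quotient_minimalPrimes_two_le`.
* Part E: `Pasten2024.log_modularDegree_lt_of_thm_5_5_asymptotic'` (Thm 7.2 asymptotic clause with
  the count as an asymptotic hypothesis, then discharged: `Pasten2024.exists_sum_erase_finrank_quotient_le`),
  `pasten_thm_7_5_of_modularity_of_murtyLemma_of_weight_two_bound`,
  **`pasten_thm_7_5_of_modularity_of_murtyLemma`**.

## Status of `pasten_thm_7_5`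

`pasten_thm_7_5_holds` is NOT here: it needs the Modularity Theorem
(`nonempty_modularParametrizationData`), Mazur–Kenku, Thm 5.5 and Deligne's bound (named facts of
the tree, unproved) and Murty's Lemma 11 ([MurtyBounds] §6 Lemma 11: Rankin–Selberg with the
level-uniform convexity bound and the Hoffstein–Lockhart lower bound for `(f, f)`; not vendored).
Nothing else of the printed proof of Thm 7.5 remains unproved.

## References

* H. Pasten, *Shimura curves and the abc conjecture*, J. Number Theory 254 (2024), 214–335,
  doi:10.1016/j.jnt.2023.07.002 = arXiv:1705.09251: §4.9–4.11 (p. 16), §7.1 with Prop. 7.1 and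
  Thm 7.2 with its proof (p. 26), §7.4 Thm 7.5 (p. 27). [PastenShimura2024]
* M. R. Murty, *Bounds for congruence primes*, Proc. Sympos. Pure Math. 66.1 (1999) 177–192, §6
  Lemma 11. [Murty1999CongruencePrimes]
* A. O. L. Atkin, J. Lehner, *Hecke operators on `Γ₀(m)`*, Math. Ann. 185 (1970), Thms. 3, 5.
  [AtkinLehner1970]
* F. Diamond, J. Shurman, *A first course in modular forms*, GTM 228 (2005), Thm. 3.1.1, 3.5.1,
  5.5.3, 5.8.3. [DiamondShurman2005]
* G. Shimura, *Introduction to the arithmetic theory of automorphic functions* (1971), Thm. 3.48.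
  [Shimura1971]
* P. Deligne, *La conjecture de Weil. I*, Publ. Math. IHÉS 43 (1974), Thm. 8.2. [Deligne1974]
-/

noncomputable section

open scoped MatrixGroups ModularForm ComplexConjugate

open CongruenceSubgroup UpperHalfPlane

namespace Literature.NumberTheory.EllipticCurves.ModularForms

/-! ### Part A. `Σ_{P minimal} rank_ℤ(𝕋 ⧸ P) ≤ rank_ℤ 𝕋` -/

section RankSumGeneral

variable {R : Type*} [CommRing R]

/-- Avoidance elements for a finite set `s` of pairwise incomparable primes: for `P ∈ s` an
element `e_P ∉ P` lying in every other `Q ∈ s`. [folklore] -/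
theorem exists_notMem_forall_mem_of_pairwise_not_le (s : Finset (Ideal R))
    (hprime : ∀ P ∈ s, P.IsPrime) (hinc : ∀ P ∈ s, ∀ Q ∈ s, P ≠ Q → ¬ Q ≤ P)
    {P : Ideal R} (hP : P ∈ s) : ∃ e : R, e ∉ P ∧ ∀ Q ∈ s, Q ≠ P → e ∈ Q := by
  classical
  haveI : P.IsPrime := hprime P hP
  have hch : ∀ Q ∈ s.erase P, ∃ a : R, a ∈ Q ∧ a ∉ P := fun Q hQ ↦ by
    obtain ⟨a, haQ, haP⟩ := SetLike.not_le_iff_exists.mp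
      (hinc P hP Q (Finset.mem_of_mem_erase hQ) (Finset.ne_of_mem_erase hQ).symm)
    exact ⟨a, haQ, haP⟩
  choose! a haQ haP using hch
  refine ⟨∏ Q ∈ s.erase P, a Q, ?_, fun Q hQ hQP ↦ ?_⟩
  · rw [Ideal.IsPrime.prod_mem_iff]
    rintro ⟨Q, hQ, hQa⟩
    exact haP Q hQ hQa
  · have hQ' : Q ∈ s.erase P := Finset.mem_erase.mpr ⟨hQP, hQ⟩
    rw [← Finset.mul_prod_erase _ _ hQ']
    exact Ideal.mul_mem_right _ _ (haQ Q hQ')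

/-- **`Σ_{P ∈ s} rank_ℤ(R ⧸ P) ≤ rank_ℤ R`** for a commutative ring `R` finite over `ℤ` and a finite
set `s` of pairwise incomparable prime ideals with `R ⧸ P` free over `ℤ` (e.g. minimal primes of
a torsion-free `R`). Proof: for `P ∈ s` pick `e_P ∈ ⋂_{Q ∈ s, Q ≠ P} Q` with `e_P ∉ P` and lifts
`u_{P,l} ∈ R` of a `ℤ`-basis of `R ⧸ P`; the family `e_P u_{P,l}` is `ℤ`-linearly independent in
`R` (reduce a relation modulo `P₀`: the terms with `P ≠ P₀` die and `ē_{P₀} ≠ 0` in the domain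
`R ⧸ P₀`), and it has `Σ_{P ∈ s} rank_ℤ(R ⧸ P)` members. (Equivalently: `R ⊗ ℚ ↠ ∏_P (R ⧸ P) ⊗ ℚ`
by the Chinese remainder theorem.) [folklore] -/
theorem sum_finrank_quotient_le_finrank_of_pairwise_not_le [Module.Finite ℤ R]
    (s : Finset (Ideal R)) (hprime : ∀ P ∈ s, P.IsPrime)
    (hinc : ∀ P ∈ s, ∀ Q ∈ s, P ≠ Q → ¬ Q ≤ P) (hfree : ∀ P ∈ s, Module.Free ℤ (R ⧸ P)) :
    ∑ P ∈ s, Module.finrank ℤ (R ⧸ P) ≤ Module.finrank ℤ R := by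
  classical
  -- avoidance elements
  have hav : ∀ P ∈ s, ∃ e : R, e ∉ P ∧ ∀ Q ∈ s, Q ≠ P → e ∈ Q :=
    fun P hP ↦ exists_notMem_forall_mem_of_pairwise_not_le s hprime hinc hP
  choose! e heP heQ using hav
  -- linearly independent families of full size in the quotients, and lifts
  have hbasis : ∀ P ∈ s, ∃ b : Fin (Module.finrank ℤ (R ⧸ P)) → R ⧸ P, LinearIndependent ℤ b := by
    intro P hP
    haveI := hfree P hP
    haveI : Module.Finite ℤ (R ⧸ P) := Module.Finite.of_surjective
      (Ideal.Quotient.mkₐ ℤ P).toLinearMap (Ideal.Quotient.mkₐ_surjective ℤ P)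
    exact ⟨Module.finBasis ℤ _, (Module.finBasis ℤ _).linearIndependent⟩
  choose! b hb using hbasis
  have hlift : ∀ (P : Ideal R) (l : Fin (Module.finrank ℤ (R ⧸ P))),
      ∃ u : R, Ideal.Quotient.mk P u = b P l :=
    fun P l ↦ Ideal.Quotient.mk_surjective (b P l)
  choose u hu using hlift
  -- the family `(P, l) ↦ e_P u_{P,l}` is linearly independent
  have hw : LinearIndependent ℤ
      fun i : (Σ P : ↥s, Fin (Module.finrank ℤ (R ⧸ P.1))) ↦ e i.1.1 * u i.1.1 i.2 := by
    rw [Fintype.linearIndependent_iff]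
    rintro c hc ⟨P₀, l₀⟩
    haveI : P₀.1.IsPrime := hprime P₀.1 P₀.2
    -- reduce modulo `P₀`
    have hc' : ∑ i : (Σ P : ↥s, Fin (Module.finrank ℤ (R ⧸ P.1))),
        (c i : R) * (e i.1.1 * u i.1.1 i.2) = 0 := by
      simpa only [zsmul_eq_mul] using hc
    have hred : ∑ i : (Σ P : ↥s, Fin (Module.finrank ℤ (R ⧸ P.1))),
        (c i : R ⧸ P₀.1) *
          (Ideal.Quotient.mk P₀.1 (e i.1.1) * Ideal.Quotient.mk P₀.1 (u i.1.1 i.2)) = 0 := by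
      have h := congrArg (Ideal.Quotient.mk P₀.1) hc'
      simpa only [map_sum, map_zero, map_mul, map_intCast] using h
    rw [Fintype.sum_sigma] at hred
    have hvan : ∀ P : ↥s, P ≠ P₀ →
        ∑ l : Fin (Module.finrank ℤ (R ⧸ P.1)), (c ⟨P, l⟩ : R ⧸ P₀.1) *
            (Ideal.Quotient.mk P₀.1 (e P.1) * Ideal.Quotient.mk P₀.1 (u P.1 l)) = 0 := by
      intro P hPP₀
      refine Finset.sum_eq_zero fun l _ ↦ ?_
      have hePmem : e P.1 ∈ P₀.1 := heQ P.1 P.2 P₀.1 P₀.2 (fun h ↦ hPP₀ (Subtype.ext h).symm)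
      rw [Ideal.Quotient.eq_zero_iff_mem.mpr hePmem, zero_mul, mul_zero]
    rw [Finset.sum_eq_single P₀ (fun P _ hP ↦ hvan P hP) (fun h ↦ (h (Finset.mem_univ _)).elim)]
      at hred
    have hred' : Ideal.Quotient.mk P₀.1 (e P₀.1) *
        ∑ l : Fin (Module.finrank ℤ (R ⧸ P₀.1)), (c ⟨P₀, l⟩ : R ⧸ P₀.1) * b P₀.1 l = 0 := by
      rw [Finset.mul_sum, ← hred]
      refine Finset.sum_congr rfl fun l _ ↦ ?_
      rw [hu]
      ring
    have he0 : Ideal.Quotient.mk P₀.1 (e P₀.1) ≠ 0 := fun h ↦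
      heP P₀.1 P₀.2 (Ideal.Quotient.eq_zero_iff_mem.mp h)
    have hsum : ∑ l : Fin (Module.finrank ℤ (R ⧸ P₀.1)), c ⟨P₀, l⟩ • b P₀.1 l = 0 := by
      simpa only [zsmul_eq_mul] using (mul_eq_zero.mp hred').resolve_left he0
    exact Fintype.linearIndependent_iff.mp (hb P₀.1 P₀.2) (fun l ↦ c ⟨P₀, l⟩) hsum l₀
  have hcard := hw.fintype_card_le_finrank
  rw [Fintype.card_sigma] at hcard
  simp only [Fintype.card_fin] at hcard
  rwa [Finset.sum_coe_sort s (fun P ↦ Module.finrank ℤ (R ⧸ P))] at hcard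

end RankSumGeneral

section RankSum

variable {N : ℕ} [NeZero N] {k : ℤ}

/-- **`Σ_{P ∈ s} rank_ℤ(𝕋 ⧸ P) ≤ rank_ℤ 𝕋`** for any finite set `s` of minimal primes of the Hecke
ring `𝕋 = anemicHeckeRing N k`: distinct minimal primes are incomparable and the quotients
`𝕋 ⧸ P` are free (`free_quotient_of_mem_minimalPrimes`). With `#c = rank_ℤ(𝕋 ⧸ 𝕀_{[χ]})`
(Pasten 2024, §4.11) this is `Σ_c #c ≤ rank_ℤ 𝕋_{1,N}`. [folklore] -/
theorem sum_finrank_quotient_le_finrank (s : Finset (Ideal (anemicHeckeRing N k)))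
    (hs : ∀ P ∈ s, P ∈ minimalPrimes (anemicHeckeRing N k)) :
    ∑ P ∈ s, Module.finrank ℤ (anemicHeckeRing N k ⧸ P) ≤
      Module.finrank ℤ (anemicHeckeRing N k) :=
  sum_finrank_quotient_le_finrank_of_pairwise_not_le s (fun P hP ↦ (hs P hP).1.1)
    (fun P hP Q hQ hPQ hle ↦ hPQ (le_antisymm ((hs P hP).2 ⟨(hs Q hQ).1.1, bot_le⟩ hle) hle))
    (fun P hP ↦ free_quotient_of_mem_minimalPrimes (hs P hP))

/-- **`Σ_{P minimal} rank_ℤ(𝕋 ⧸ P) ≤ rank_ℤ 𝕋`**, over all the (finitely many) minimal primes of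
`𝕋`. [folklore] -/
theorem sum_finrank_quotient_minimalPrimes_le_finrank :
    ∑ P ∈ (finite_minimalPrimes_anemicHeckeRing N k).toFinset,
        Module.finrank ℤ (anemicHeckeRing N k ⧸ P) ≤
      Module.finrank ℤ (anemicHeckeRing N k) :=
  sum_finrank_quotient_le_finrank _ fun _ hP ↦
    (finite_minimalPrimes_anemicHeckeRing N k).mem_toFinset.mp hP

end RankSum

/-! ### Part B. `rank_ℤ 𝕋 ≤ #{systems of eigenvalues}` (lattice and reality) -/

section RankLeSystems

variable {N : ℕ} [NeZero N] {k : ℤ}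

/-- **Systems of Hecke eigenvalues on `S_k(Γ₀(N))` are real**: for a nonzero simultaneous
eigenvector `f` and every `t ∈ 𝕋 = ℤ[T_p : p ∤ N]`, the eigenvalue `χ_f(t)` is real — the `T_p`,
`p ∤ N`, are self-adjoint (`conj_eq_of_heckeT_eq_smul`, Diamond–Shurman Thm. 5.5.3) and `χ_f` is a
ring map. [cite: DiamondShurman2005, Thm. 5.5.3] -/
theorem conj_anemicEigenvalue {f : CuspForm (Gamma0 N) k} (hf : IsAnemicEigenvector f)
    (hf0 : f ≠ 0) (t : anemicHeckeRing N k) : conj (anemicEigenvalue f t) = anemicEigenvalue f t := by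
  change conj (eigencharacter hf hf0 t) = eigencharacter hf hf0 t
  obtain ⟨t, ht⟩ := t
  induction ht using Algebra.adjoin_induction with
  | mem x hx =>
    obtain ⟨p, hp, hpN, rfl⟩ := hx
    haveI : NeZero p := ⟨hp.ne_zero⟩
    have h := eigencharacter_spec hf hf0 ⟨heckeT (Gamma0 N) k p, heckeT_mem_anemicHeckeRing N k p hp hpN⟩
    exact conj_eq_of_heckeT_eq_smul hp hpN hf0 h
  | algebraMap r =>
    have hr : (algebraMap ℤ (Module.End ℂ (CuspForm (Gamma0 N) k)) r) f = ((r : ℤ) : ℂ) • f := by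
      rw [Algebra.algebraMap_eq_smul_one, LinearMap.smul_apply, Module.End.one_apply,
        Int.cast_smul_eq_zsmul]
    rw [eigencharacter_eq_of_apply_eq_smul hf hf0 hr, map_intCast]
  | add x y hx hy hx' hy' =>
    have : (⟨x + y, add_mem hx hy⟩ : anemicHeckeRing N k) = ⟨x, hx⟩ + ⟨y, hy⟩ := rfl
    rw [this, map_add, map_add, hx', hy']
  | mul x y hx hy hx' hy' =>
    have : (⟨x * y, mul_mem hx hy⟩ : anemicHeckeRing N k) = ⟨x, hx⟩ * ⟨y, hy⟩ := rfl
    rw [this, map_mul, map_mul, hx', hy']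

/-- The eigenvalue of `t ∈ 𝕋` on a nonzero simultaneous eigenvector is the real number
`re χ_f(t)`. [folklore] -/
theorem anemicEigenvalue_eq_ofReal_re {f : CuspForm (Gamma0 N) k} (hf : IsAnemicEigenvector f)
    (hf0 : f ≠ 0) (t : anemicHeckeRing N k) :
    anemicEigenvalue f t = ((anemicEigenvalue f t).re : ℂ) :=
  (Complex.conj_eq_iff_re.mp (conj_anemicEigenvalue hf hf0 t)).symm

/-- **Every element of `𝕋` preserves the Hecke-stable lattice**: if the `ℤ`-span `Λ` of a family
`b` is stable under all `T_p`, it is stable under `𝕋 = ℤ[T_p : p ∤ N]`. [folklore] -/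
theorem apply_mem_span_of_heckeStable {n : ℕ} (b : Fin n → CuspForm (Gamma0 N) k)
    (hb : ∀ (p : ℕ) (hp : p.Prime) (i : Fin n),
      (haveI : NeZero p := ⟨hp.ne_zero⟩; heckeT (Gamma0 N) k p (b i)) ∈
        Submodule.span ℤ (Set.range b))
    (t : anemicHeckeRing N k) (j : Fin n) :
    (t : Module.End ℂ (CuspForm (Gamma0 N) k)) (b j) ∈ Submodule.span ℤ (Set.range b) := by
  obtain ⟨t, ht⟩ := t
  change t (b j) ∈ Submodule.span ℤ (Set.range b)
  induction ht using Algebra.adjoin_induction generalizing j with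
  | mem x hx =>
    obtain ⟨p, hp, -, rfl⟩ := hx
    exact hb p hp j
  | algebraMap r =>
    rw [Algebra.algebraMap_eq_smul_one, LinearMap.smul_apply, Module.End.one_apply]
    exact Submodule.smul_mem _ r (Submodule.subset_span ⟨j, rfl⟩)
  | add x y _ _ hx' hy' =>
    rw [LinearMap.add_apply]
    exact Submodule.add_mem _ (hx' j) (hy' j)
  | mul x y _ _ hx' hy' =>
    rw [Module.End.mul_apply]
    -- `x` maps the lattice into itself
    have hxΛ : ∀ w ∈ Submodule.span ℤ (Set.range b), x w ∈ Submodule.span ℤ (Set.range b) := by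
      intro w hw
      refine Submodule.span_induction (p := fun w _ ↦ x w ∈ Submodule.span ℤ (Set.range b))
        ?_ ?_ ?_ ?_ hw
      · rintro _ ⟨i, rfl⟩
        exact hx' i
      · rw [map_zero]; exact Submodule.zero_mem _
      · intro u w _ _ hu hw
        rw [map_add]; exact Submodule.add_mem _ hu hw
      · intro m w _ hw
        rw [map_zsmul]; exact Submodule.smul_mem _ m hw
    exact hxΛ _ (hy' j)

/-- **`rank_ℤ 𝕋 ≤ #{systems of Hecke eigenvalues}`.** Let `v` be a basis of `S_k(Γ₀(N))`
consisting of simultaneous eigenvectors of the `T_p`, `p ∤ N`, with systems of eigenvalues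
`χ_i : 𝕋 → ℂ`. Then the `ℤ`-rank of `𝕋 = ℤ[T_p : p ∤ N]` is at most the number of DISTINCT
systems `χ_i`. Proof: a `ℤ`-basis `β_l` of `𝕋` has integer matrices `A_l` in the Hecke-stable
real basis `b` of `S_k(Γ₀(N))` (Shimura's lattice, `exists_heckeStable_realBasis`), so the `A_l`
are `ℚ`-linearly independent; if a real combination `Σ c_l re χ(β_l)` vanishes for every system
`χ = χ_i`, then (the `χ_i(β_l)` being real) the operator `Σ c_l β_l` kills every `v_i`, hence
vanishes, so `Σ c_l A_l = 0`; applying any `ℚ`-linear `π : ℝ → ℚ` gives `Σ π(c_l) A_l = 0`, so all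
`π(c_l) = 0`, so `c = 0`. Thus `l ↦ (re χ(β_l))_χ` is an `ℝ`-linearly independent family of
`rank_ℤ 𝕋` vectors in `ℝ^{systems}`. (Pasten 2024, §4.9–4.11: `𝕋 ⊗ ℂ ≅ ∏_χ ℂ` over the systems of
Hecke eigenvalues; here only the inequality is needed.) [cite: PastenShimura2024, §4.11 p. 16] -/
theorem finrank_anemicHeckeRing_le_card_systems {ι : Type*} [Fintype ι]
    (v : ι → CuspForm (Gamma0 N) k) (hv : LinearIndependent ℂ v)
    (hsp : ⊤ ≤ Submodule.span ℂ (Set.range v)) (hev : ∀ i, IsAnemicEigenvector (v i))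
    (X : Finset (anemicHeckeRing N k → ℂ)) (hX : ∀ i, anemicEigenvalue (v i) ∈ X) :
    Module.finrank ℤ (anemicHeckeRing N k) ≤ X.card := by
  classical
  have hv0 : ∀ i, v i ≠ 0 := fun i ↦ hv.ne_zero i
  -- the eigenvalues are real
  have hre : ∀ i t, anemicEigenvalue (v i) t = ((anemicEigenvalue (v i) t).re : ℂ) :=
    fun i t ↦ anemicEigenvalue_eq_ofReal_re (hev i) (hv0 i) t
  -- Shimura's lattice and the integer matrices of a `ℤ`-basis of `𝕋`
  obtain ⟨n, b, hb⟩ := exists_heckeStable_realBasis N k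
  set r := Module.finrank ℤ (anemicHeckeRing N k) with hr
  let β := Module.finBasis ℤ (anemicHeckeRing N k)
  have hA : ∀ (l : Fin r) (j : Fin n), ∃ a : Fin n → ℤ,
      ∑ i, a i • b i = (β l : Module.End ℂ (CuspForm (Gamma0 N) k)) (b j) := fun l j ↦
    (Submodule.mem_span_range_iff_exists_fun ℤ).mp (apply_mem_span_of_heckeStable b hb (β l) j)
  choose A hA using hA
  -- an operator vanishing on the real basis `b` vanishes
  have hbext : ∀ T : Module.End ℂ (CuspForm (Gamma0 N) k), (∀ j, T (b j) = 0) → T = 0 := by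
    intro T hTb
    refine LinearMap.ext fun w ↦ ?_
    rw [LinearMap.zero_apply, ← b.sum_repr w, map_sum]
    exact Finset.sum_eq_zero fun j _ ↦ by rw [T.map_smul_of_tower (b.repr w j) (b j), hTb, smul_zero]
  -- integer combinations of the `β l` on the real basis
  have hcombZ : ∀ (m : Fin r → ℤ) (j : Fin n),
      (∑ l, m l • (β l : Module.End ℂ (CuspForm (Gamma0 N) k))) (b j) =
        ∑ i, (∑ l, m l * A l j i) • b i := by
    intro m j
    rw [LinearMap.sum_apply]
    simp_rw [LinearMap.smul_apply, ← hA, Finset.smul_sum, smul_smul, Finset.sum_smul]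
    exact Finset.sum_comm
  -- the `A l` are `ℤ`-, hence `ℚ`-linearly independent
  have hAind : LinearIndependent ℚ fun l : Fin r ↦ (fun j i ↦ (A l j i : ℚ)) := by
    rw [← LinearIndependent.iff_fractionRing ℤ ℚ, Fintype.linearIndependent_iff]
    intro m hm l₀
    -- `Σ m_l A_l = 0` as integer matrices
    have hmA : ∀ j i, ∑ l, m l * A l j i = 0 := fun j i ↦ by
      have h := congrFun (congrFun hm j) i
      simp only [Finset.sum_apply, Pi.smul_apply, Pi.zero_apply] at h
      simp only [zsmul_eq_mul] at h
      exact_mod_cast h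
    -- hence the operator `Σ m_l β_l` kills the real basis `b`, so it is `0`
    have hop : ∑ l, m l • β l = 0 := by
      have hcoe : ((∑ l, m l • β l : anemicHeckeRing N k) :
          Module.End ℂ (CuspForm (Gamma0 N) k)) =
          ∑ l, m l • (β l : Module.End ℂ (CuspForm (Gamma0 N) k)) := by
        rw [← Subalgebra.coe_val, map_sum]
        exact Finset.sum_congr rfl fun l _ ↦ by rw [map_zsmul, Subalgebra.coe_val]
      have hval : ((∑ l, m l • β l : anemicHeckeRing N k) :
          Module.End ℂ (CuspForm (Gamma0 N) k)) = 0 := by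
        rw [hcoe]
        refine hbext _ fun j ↦ ?_
        rw [hcombZ m j]
        exact Finset.sum_eq_zero fun i _ ↦ by rw [hmA j i, zero_smul]
      exact Subtype.ext hval
    exact Fintype.linearIndependent_iff.mp β.linearIndependent m hop l₀
  -- the real-linearly independent family in `ℝ^X`
  let F : Fin r → (↥X → ℝ) := fun l x ↦ (x.1 (β l)).re
  suffices hF : LinearIndependent ℝ F by
    have h := hF.fintype_card_le_finrank
    rwa [Fintype.card_fin, Module.finrank_fintype_fun_eq_card, Fintype.card_coe] at h
  rw [Fintype.linearIndependent_iff]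
  intro c hc
  -- the combination vanishes at every system `χ_i`
  have hci : ∀ i, ∑ l, c l * (anemicEigenvalue (v i) (β l)).re = 0 := fun i ↦ by
    have h := congrFun hc ⟨anemicEigenvalue (v i), hX i⟩
    simpa [F, Finset.sum_apply, Pi.smul_apply, smul_eq_mul] using h
  -- so the operator `Σ c_l β_l` vanishes
  have hT : (∑ l, (c l : ℂ) • (β l : Module.End ℂ (CuspForm (Gamma0 N) k))) = 0 := by
    refine (Module.Basis.mk hv hsp).ext fun i ↦ ?_
    rw [Module.Basis.coe_mk, LinearMap.zero_apply, LinearMap.sum_apply]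
    simp_rw [LinearMap.smul_apply, (hev i).apply_eq_smul, smul_smul, ← Finset.sum_smul]
    rw [show ∑ l, (c l : ℂ) * anemicEigenvalue (v i) (β l) =
        ((∑ l, c l * (anemicEigenvalue (v i) (β l)).re : ℝ) : ℂ) by
      rw [Complex.ofReal_sum]
      exact Finset.sum_congr rfl fun l _ ↦ by rw [hre i, Complex.ofReal_re, Complex.ofReal_mul],
      hci i, Complex.ofReal_zero, zero_smul]
  -- hence the real relation `Σ c_l A_l = 0`
  have hcA : ∀ j i, ∑ l, c l * (A l j i : ℝ) = 0 := by
    intro j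
    have hj : (∑ l, (c l : ℂ) • (β l : Module.End ℂ (CuspForm (Gamma0 N) k))) (b j) = 0 := by
      rw [hT, LinearMap.zero_apply]
    rw [LinearMap.sum_apply] at hj
    simp_rw [LinearMap.smul_apply, ← hA, Finset.smul_sum, Complex.coe_smul] at hj
    have hj' : ∑ i, (∑ l, c l * (A l j i : ℝ)) • b i = 0 := by
      rw [← hj, Finset.sum_comm]
      refine Finset.sum_congr rfl fun i _ ↦ ?_
      rw [Finset.sum_smul]
      refine Finset.sum_congr rfl fun l _ ↦ ?_
      rw [← Int.cast_smul_eq_zsmul ℝ (A l j i) (b i), smul_smul]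
    exact Fintype.linearIndependent_iff.mp b.linearIndependent _ hj'
  -- apply rational functionals
  intro l₀
  by_contra hl₀
  obtain ⟨π, hπ⟩ := Module.Projective.exists_dual_ne_zero ℚ hl₀
  have hq : ∑ l, (π (c l)) • (fun j i ↦ (A l j i : ℚ)) = 0 := by
    funext j i
    simp only [Finset.sum_apply, Pi.smul_apply, Pi.zero_apply, smul_eq_mul]
    have h := congrArg π (hcA j i)
    rw [map_sum, map_zero] at h
    rw [← h]
    refine Finset.sum_congr rfl fun l _ ↦ ?_
    rw [show c l * (A l j i : ℝ) = (A l j i : ℤ) • c l by rw [zsmul_eq_mul, mul_comm],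
      map_zsmul, zsmul_eq_mul, mul_comm]
  exact hπ (Fintype.linearIndependent_iff.mp hAind (fun l ↦ π (c l)) hq l₀)

end RankLeSystems

/-! ### Part C. The Atkin–Lehner eigenbasis and the count of eigen-systems -/

section Systems

variable {N : ℕ} [NeZero N] {k : ℤ}

/-- Two nonzero simultaneous eigenvectors with the same `T_p`-eigenvalues for all `p ∤ N` have
the same system of eigenvalues on all of `𝕋 = ℤ[T_p : p ∤ N]`. [folklore] -/
theorem anemicEigenvalue_eq_of_forall_heckeT_eq_smul {φ ψ : CuspForm (Gamma0 N) k}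
    (hφ : IsAnemicEigenvector φ) (hφ0 : φ ≠ 0) (hψ : IsAnemicEigenvector ψ) (hψ0 : ψ ≠ 0)
    (h : ∀ (p : ℕ) (hp : p.Prime), ¬ p ∣ N → ∃ c : ℂ,
      (haveI : NeZero p := ⟨hp.ne_zero⟩; heckeT (Gamma0 N) k p φ) = c • φ ∧
        (haveI : NeZero p := ⟨hp.ne_zero⟩; heckeT (Gamma0 N) k p ψ) = c • ψ) :
    anemicEigenvalue φ = anemicEigenvalue ψ := by
  have hχ' : eigencharacter hφ hφ0 = eigencharacter hψ hψ0 := by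
    refine RingHom.ext fun t ↦ ?_
    obtain ⟨t, ht⟩ := t
    induction ht using Algebra.adjoin_induction with
    | mem x hx =>
      obtain ⟨p, hp, hpN, rfl⟩ := hx
      obtain ⟨c, hcφ, hcψ⟩ := h p hp hpN
      exact (eigencharacter_eq_of_apply_eq_smul hφ hφ0 hcφ).trans
        (eigencharacter_eq_of_apply_eq_smul hψ hψ0 hcψ).symm
    | algebraMap r =>
      have hr : ∀ (ξ : CuspForm (Gamma0 N) k),
          (algebraMap ℤ (Module.End ℂ (CuspForm (Gamma0 N) k)) r) ξ = ((r : ℤ) : ℂ) • ξ := fun ξ ↦ by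
        rw [Algebra.algebraMap_eq_smul_one, LinearMap.smul_apply, Module.End.one_apply,
          Int.cast_smul_eq_zsmul]
      exact (eigencharacter_eq_of_apply_eq_smul hφ hφ0 (hr φ)).trans
        (eigencharacter_eq_of_apply_eq_smul hψ hψ0 (hr ψ)).symm
    | add x y hx hy hx' hy' =>
      have : (⟨x + y, add_mem hx hy⟩ : anemicHeckeRing N k) = ⟨x, hx⟩ + ⟨y, hy⟩ := rfl
      rw [this, map_add, map_add, hx', hy']
    | mul x y hx hy hx' hy' =>
      have : (⟨x * y, mul_mem hx hy⟩ : anemicHeckeRing N k) = ⟨x, hx⟩ * ⟨y, hy⟩ := rfl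
      rw [this, map_mul, map_mul, hx', hy']
  funext t
  exact congrArg (fun χ : anemicHeckeRing N k →+* ℂ ↦ χ t) hχ'

end Systems

section ALBasis

variable (L : ℕ) [NeZero L] (k : ℤ)

/-- **The Atkin–Lehner family spans `S_k(Γ₀(L))`**: the forms `[α_d]_k g`, `g` a newform of level
`M`, `M d ∣ L` (indexed as in `linearIndependent_degeneracyMap0_newforms`), span — the spanning
half of the Atkin–Lehner decomposition (`iSup_atkinLehnerComponent_eq_top`) with
`atkinLehnerComponent_eq_span_image`. [cite: AtkinLehner1970, Thm. 5] -/
theorem span_degeneracyMap0_newforms_eq_top :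
    ⊤ ≤ Submodule.span ℂ (Set.range fun t : (Σ j : (Σ y : {y : AtkinLehnerIndex L // y.1.2 = 1},
        ↥(newforms0 y.1.1.1 k)), {x : AtkinLehnerIndex L // x.1.1 = j.1.1.1.1}) ↦
      degeneracyMap0 t.1.1.1.1.1 L t.2.1.1.2 k t.1.2.1) := by
  rw [← iSup_atkinLehnerComponent_eq_top k L]
  refine iSup_le fun x ↦ ?_
  rw [atkinLehnerComponent_eq_span_image L k x]
  exact Submodule.span_mono (Set.image_subset_range _ _)

/-- Every member `[α_d]_k g` of the Atkin–Lehner family is a simultaneous eigenvector of the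
`T_p`, `p ∤ L`, with eigenvalues `a_p(g)` (`heckeT_degeneracyMap0`, Atkin–Lehner 1970, Thm. 3).
[cite: AtkinLehner1970, Thm. 3] -/
theorem heckeT_degeneracyMap0_newforms_eq_coeff_smul
    (t : (Σ j : (Σ y : {y : AtkinLehnerIndex L // y.1.2 = 1}, ↥(newforms0 y.1.1.1 k)),
      {x : AtkinLehnerIndex L // x.1.1 = j.1.1.1.1}))
    (p : ℕ) [NeZero p] (hp : p.Prime) (hpL : ¬ p ∣ L) :
    heckeT (Gamma0 L) k p (degeneracyMap0 t.1.1.1.1.1 L t.2.1.1.2 k t.1.2.1) =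
      (qExpansion 1 ⇑(t.1.2.1)).coeff p • degeneracyMap0 t.1.1.1.1.1 L t.2.1.1.2 k t.1.2.1 := by
  rw [heckeT_degeneracyMap0 (mul_dvd_of_atkinLehnerIndex_fst_eq t.2) hp hpL,
    IsNewform0.heckeT_eq_coeff_smul (show IsNewform0 t.1.2.1 from t.1.2.2) hp, map_smul]

/-- The members of the Atkin–Lehner family are anemic simultaneous eigenvectors. [folklore] -/
theorem isAnemicEigenvector_degeneracyMap0_newforms
    (t : (Σ j : (Σ y : {y : AtkinLehnerIndex L // y.1.2 = 1}, ↥(newforms0 y.1.1.1 k)),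
      {x : AtkinLehnerIndex L // x.1.1 = j.1.1.1.1})) :
    IsAnemicEigenvector (degeneracyMap0 t.1.1.1.1.1 L t.2.1.1.2 k t.1.2.1) := fun p hp hpL ↦ by
  haveI : NeZero p := ⟨hp.ne_zero⟩
  exact ⟨_, heckeT_degeneracyMap0_newforms_eq_coeff_smul L k t p hp hpL⟩

/-- The members of the Atkin–Lehner family are nonzero. [folklore] -/
theorem degeneracyMap0_newforms_ne_zero
    (t : (Σ j : (Σ y : {y : AtkinLehnerIndex L // y.1.2 = 1}, ↥(newforms0 y.1.1.1 k)),
      {x : AtkinLehnerIndex L // x.1.1 = j.1.1.1.1})) :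
    degeneracyMap0 t.1.1.1.1.1 L t.2.1.1.2 k t.1.2.1 ≠ 0 :=
  (linearIndependent_degeneracyMap0_newforms L k).ne_zero t

/-- **The system of eigenvalues of `[α_d]_k g` is that of `g`** (it does not depend on `d`): it is
the system of the member `[α_{d₀}]_k g` indexed by `((M, d₀), g)` itself (`d₀ = 1`). [folklore] -/
theorem anemicEigenvalue_degeneracyMap0_newforms_eq
    (t : (Σ j : (Σ y : {y : AtkinLehnerIndex L // y.1.2 = 1}, ↥(newforms0 y.1.1.1 k)),
      {x : AtkinLehnerIndex L // x.1.1 = j.1.1.1.1})) :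
    anemicEigenvalue (degeneracyMap0 t.1.1.1.1.1 L t.2.1.1.2 k t.1.2.1) =
      anemicEigenvalue (degeneracyMap0 t.1.1.1.1.1 L t.1.1.1.1.2 k t.1.2.1) := by
  let t' : (Σ j : (Σ y : {y : AtkinLehnerIndex L // y.1.2 = 1}, ↥(newforms0 y.1.1.1 k)),
      {x : AtkinLehnerIndex L // x.1.1 = j.1.1.1.1}) := ⟨t.1, ⟨t.1.1.1, rfl⟩⟩
  refine anemicEigenvalue_eq_of_forall_heckeT_eq_smul
    (isAnemicEigenvector_degeneracyMap0_newforms L k t) (degeneracyMap0_newforms_ne_zero L k t)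
    (isAnemicEigenvector_degeneracyMap0_newforms L k t') (degeneracyMap0_newforms_ne_zero L k t')
    fun p hp hpL ↦ ?_
  haveI : NeZero p := ⟨hp.ne_zero⟩
  exact ⟨_, heckeT_degeneracyMap0_newforms_eq_coeff_smul L k t p hp hpL,
    heckeT_degeneracyMap0_newforms_eq_coeff_smul L k t' p hp hpL⟩

end ALBasis

section ALCount

variable (L : ℕ) [NeZero L] (k : ℤ)

/-- **The number of pairs `(M, g)`, `M ∣ L`, `g` a newform of level `M`** (the base of the
Atkin–Lehner family) is `Σ_{M ∣ L} #newforms0(M)`. Here `n` is any function with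
`n M = #newforms0 M k` for `M ≥ 1`. [folklore] -/
theorem natCard_sigma_newforms0_eq_sum_divisors (n : ℕ → ℕ)
    (hn : ∀ (M : ℕ) [NeZero M], n M = Nat.card ↥(newforms0 M k)) :
    Nat.card (Σ y : {y : AtkinLehnerIndex L // y.1.2 = 1}, ↥(newforms0 y.1.1.1 k)) =
      ∑ M ∈ L.divisors, n M := by
  classical
  haveI := finite_atkinLehnerIndex L
  haveI : Fintype (AtkinLehnerIndex L) := Fintype.ofFinite _
  haveI : ∀ y : {y : AtkinLehnerIndex L // y.1.2 = 1}, Fintype ↥(newforms0 y.1.1.1 k) :=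
    fun y ↦ (finite_newforms0_holds y.1.1.1 k).fintype
  -- the levels `M` of the indices `(M, 1)` are the divisors of `L`
  let e : {y : AtkinLehnerIndex L // y.1.2 = 1} ≃ ↥L.divisors :=
    { toFun := fun y ↦ ⟨y.1.1.1, Nat.mem_divisors.mpr ⟨(dvd_mul_right _ _).trans y.1.2, NeZero.ne L⟩⟩
      invFun := fun M ↦ ⟨⟨(M.1, 1), by rw [mul_one]; exact Nat.dvd_of_mem_divisors M.2⟩, rfl⟩
      left_inv := fun y ↦ by
        rcases y with ⟨⟨⟨M, d⟩, h⟩, hd⟩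
        change d = 1 at hd
        subst hd
        rfl
      right_inv := fun M ↦ Subtype.ext rfl }
  rw [Nat.card_eq_fintype_card, Fintype.card_sigma]
  rw [Fintype.sum_equiv e (fun y ↦ Fintype.card ↥(newforms0 y.1.1.1 k)) (fun M ↦ n M.1)
    (fun y ↦ by change _ = n y.1.1.1; rw [hn, Nat.card_eq_fintype_card])]
  exact Finset.sum_coe_sort L.divisors n

/-- **The Atkin–Lehner family has `Σ_{M ∣ L} #newforms0(M) · d(L/M)` members** (pairs
`((M, g), d)` with `M d ∣ L`). [folklore] -/
theorem natCard_index_degeneracyMap0_newforms_eq_sum_divisors (n : ℕ → ℕ)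
    (hn : ∀ (M : ℕ) [NeZero M], n M = Nat.card ↥(newforms0 M k)) :
    Nat.card (Σ j : (Σ y : {y : AtkinLehnerIndex L // y.1.2 = 1}, ↥(newforms0 y.1.1.1 k)),
        {x : AtkinLehnerIndex L // x.1.1 = j.1.1.1.1}) =
      ∑ M ∈ L.divisors, n M * (L / M).divisors.card := by
  classical
  haveI := finite_atkinLehnerIndex L
  haveI : Fintype (AtkinLehnerIndex L) := Fintype.ofFinite _
  haveI : ∀ y : {y : AtkinLehnerIndex L // y.1.2 = 1}, Fintype ↥(newforms0 y.1.1.1 k) :=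
    fun y ↦ (finite_newforms0_holds y.1.1.1 k).fintype
  have hL : L ≠ 0 := NeZero.ne L
  -- the fibre over `(M, g)` is `{d : M d ∣ L} ≃ divisors (L / M)`
  have hfib : ∀ (M : ℕ) (hM : M ∣ L),
      Fintype.card {x : AtkinLehnerIndex L // x.1.1 = M} = (L / M).divisors.card := by
    intro M hM
    have hLM : L / M ≠ 0 := (Nat.div_pos (Nat.le_of_dvd (Nat.pos_of_ne_zero hL) hM)
      (Nat.pos_of_ne_zero (ne_zero_of_dvd_ne_zero hL hM))).ne'
    let e : {x : AtkinLehnerIndex L // x.1.1 = M} ≃ ↥(L / M).divisors :=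
      { toFun := fun x ↦ ⟨x.1.1.2, Nat.mem_divisors.mpr
          ⟨(Nat.dvd_div_iff_mul_dvd hM).mpr (mul_dvd_of_atkinLehnerIndex_fst_eq x), hLM⟩⟩
        invFun := fun d ↦ ⟨⟨(M, d.1), (Nat.dvd_div_iff_mul_dvd hM).mp (Nat.dvd_of_mem_divisors d.2)⟩, rfl⟩
        left_inv := fun x ↦ by
          rcases x with ⟨⟨⟨M', d⟩, h⟩, hM'⟩
          change M' = M at hM'
          subst hM'
          rfl
        right_inv := fun d ↦ Subtype.ext rfl }
    rw [Fintype.card_congr e, Fintype.card_coe]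
  -- the levels of the indices `(M, 1)`
  let e : {y : AtkinLehnerIndex L // y.1.2 = 1} ≃ ↥L.divisors :=
    { toFun := fun y ↦ ⟨y.1.1.1, Nat.mem_divisors.mpr ⟨(dvd_mul_right _ _).trans y.1.2, hL⟩⟩
      invFun := fun M ↦ ⟨⟨(M.1, 1), by rw [mul_one]; exact Nat.dvd_of_mem_divisors M.2⟩, rfl⟩
      left_inv := fun y ↦ by
        rcases y with ⟨⟨⟨M, d⟩, h⟩, hd⟩
        change d = 1 at hd
        subst hd
        rfl
      right_inv := fun M ↦ Subtype.ext rfl }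
  rw [Nat.card_eq_fintype_card, Fintype.card_sigma, Fintype.sum_sigma]
  have hinner : ∀ y : {y : AtkinLehnerIndex L // y.1.2 = 1},
      ∑ g : ↥(newforms0 y.1.1.1 k), Fintype.card {x : AtkinLehnerIndex L // x.1.1 = y.1.1.1} =
        n y.1.1.1 * (L / y.1.1.1).divisors.card := fun y ↦ by
    rw [Finset.sum_const, Finset.card_univ, smul_eq_mul, hfib _ ((dvd_mul_right _ _).trans y.1.2),
      hn, Nat.card_eq_fintype_card]
  rw [Fintype.sum_congr _ _ hinner]
  rw [Fintype.sum_equiv e (fun y ↦ n y.1.1.1 * (L / y.1.1.1).divisors.card)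
    (fun M ↦ n M.1 * (L / M.1).divisors.card) (fun y ↦ rfl)]
  exact Finset.sum_coe_sort L.divisors (fun M ↦ n M * (L / M).divisors.card)

/-- **`dim S_k(Γ₀(L)) = Σ_{M ∣ L} #newforms0(M) · d(L/M)`** — the Atkin–Lehner family
`[α_d]_k g` (`g` a newform of level `M`, `M d ∣ L`) is a basis of `S_k(Γ₀(L))`
(`linearIndependent_degeneracyMap0_newforms` and the spanning half of the decomposition;
Atkin–Lehner 1970, Thm. 5; Diamond–Shurman Thm. 5.8.3). [cite: AtkinLehner1970, Thm. 5] -/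
theorem finrank_cuspForm_eq_sum_divisors_card_newforms0 (n : ℕ → ℕ)
    (hn : ∀ (M : ℕ) [NeZero M], n M = Nat.card ↥(newforms0 M k)) :
    Module.finrank ℂ (CuspForm (Gamma0 L) k) = ∑ M ∈ L.divisors, n M * (L / M).divisors.card := by
  classical
  haveI := finite_atkinLehnerIndex L
  haveI : Fintype (AtkinLehnerIndex L) := Fintype.ofFinite _
  haveI : ∀ y : {y : AtkinLehnerIndex L // y.1.2 = 1}, Fintype ↥(newforms0 y.1.1.1 k) :=
    fun y ↦ (finite_newforms0_holds y.1.1.1 k).fintype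
  have hsp : ⊤ ≤ Submodule.span ℂ (Set.range fun t : (Σ j : (Σ y : {y : AtkinLehnerIndex L //
      y.1.2 = 1}, ↥(newforms0 y.1.1.1 k)), {x : AtkinLehnerIndex L // x.1.1 = j.1.1.1.1}) ↦
        degeneracyMap0 t.1.1.1.1.1 L t.2.1.1.2 k t.1.2.1) := by
    rw [← iSup_atkinLehnerComponent_eq_top k L]
    refine iSup_le fun x ↦ ?_
    rw [atkinLehnerComponent_eq_span_image L k x]
    exact Submodule.span_mono (Set.image_subset_range _ _)
  rw [Module.finrank_eq_card_basis (Module.Basis.mk (linearIndependent_degeneracyMap0_newforms L k) hsp),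
    ← Nat.card_eq_fintype_card]
  exact natCard_index_degeneracyMap0_newforms_eq_sum_divisors L k n hn

end ALCount

section Moebius

/-- `Σ_{K ∣ L} Σ_{M ∣ K} n(M) = Σ_{M ∣ L} n(M) · d(L/M)` (both count the chains `M ∣ K ∣ L`).
[folklore] -/
theorem sum_divisors_sum_divisors_eq_sum_mul_card (L : ℕ) (n : ℕ → ℕ) :
    ∑ K ∈ L.divisors, ∑ M ∈ K.divisors, n M = ∑ M ∈ L.divisors, n M * (L / M).divisors.card := by
  classical
  rcases eq_or_ne L 0 with rfl | hL
  · simp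
  have h : ∀ K M, K ∈ L.divisors ∧ M ∈ K.divisors ↔
      K ∈ L.divisors.filter (M ∣ ·) ∧ M ∈ L.divisors := fun K M ↦ by
    simp only [Nat.mem_divisors, Finset.mem_filter]
    constructor
    · rintro ⟨⟨hKL, -⟩, hMK, -⟩
      exact ⟨⟨⟨hKL, hL⟩, hMK⟩, hMK.trans hKL, hL⟩
    · rintro ⟨⟨⟨hKL, -⟩, hMK⟩, -, -⟩
      exact ⟨⟨hKL, hL⟩, hMK, ne_zero_of_dvd_ne_zero hL hKL⟩
  rw [Finset.sum_comm' h]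
  refine Finset.sum_congr rfl fun M hM ↦ ?_
  rw [Finset.sum_const, smul_eq_mul, mul_comm]
  congr 1
  have hMd : M ∣ L := Nat.dvd_of_mem_divisors hM
  have hM0 : M ≠ 0 := ne_zero_of_dvd_ne_zero hL hMd
  rw [show L.divisors.filter (M ∣ ·) = (L / M).divisors.image (M * ·) from ?_,
    Finset.card_image_of_injective _ (mul_right_injective₀ hM0)]
  ext K
  simp only [Finset.mem_filter, Nat.mem_divisors, Finset.mem_image]
  constructor
  · rintro ⟨⟨hKL, -⟩, e, rfl⟩
    refine ⟨e, ⟨(Nat.dvd_div_iff_mul_dvd hMd).mpr hKL, ?_⟩, rfl⟩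
    exact (Nat.div_pos (Nat.le_of_dvd (Nat.pos_of_ne_zero hL) hMd) (Nat.pos_of_ne_zero hM0)).ne'
  · rintro ⟨e, ⟨he, -⟩, rfl⟩
    exact ⟨⟨(Nat.dvd_div_iff_mul_dvd hMd).mp he, hL⟩, dvd_mul_right M e⟩

/-- **Möbius inversion for the newform count**: `Σ_{M ∣ N} #newforms0(M) = Σ_{ab = N} μ(a) ·
dim S_k(Γ₀(b))`, from `dim S_k(Γ₀(L)) = Σ_{M ∣ L} #newforms0(M) d(L/M) = Σ_{K ∣ L} Σ_{M ∣ K}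
#newforms0(M)` for all `L ≥ 1`. This is Pasten's `r_{1,N} = Σ_{m ∣ N} s(m)` (2024, §7.1, p. 26)
solved for the left-hand side by the dimensions rather than by G. Martin's closed form for
`s(m)`. [cite: PastenShimura2024, §7.1 p. 26] -/
theorem sum_divisors_card_newforms0_eq_moebius_sum (N : ℕ) (hN : N ≠ 0) (k : ℤ) (n : ℕ → ℕ)
    (hn : ∀ (M : ℕ) [NeZero M], n M = Nat.card ↥(newforms0 M k)) :
    ((∑ M ∈ N.divisors, n M : ℕ) : ℤ) =
      ∑ x ∈ N.divisorsAntidiagonal, (ArithmeticFunction.moebius x.1 : ℤ) *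
        (Module.finrank ℂ (CuspForm (Gamma0 x.2) k) : ℤ) := by
  have key := (ArithmeticFunction.sum_eq_iff_sum_smul_moebius_eq
    (f := fun K ↦ ((∑ M ∈ K.divisors, n M : ℕ) : ℤ))
    (g := fun L ↦ (Module.finrank ℂ (CuspForm (Gamma0 L) k) : ℤ))).mp ?_ N (Nat.pos_of_ne_zero hN)
  · rw [← key]
    exact Finset.sum_congr rfl fun x _ ↦ by rw [smul_eq_mul]
  · intro L hL
    haveI : NeZero L := ⟨hL.ne'⟩
    push_cast
    rw [finrank_cuspForm_eq_sum_divisors_card_newforms0 L k n hn]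
    exact_mod_cast sum_divisors_sum_divisors_eq_sum_mul_card L n

end Moebius

/-! ### The count of eigen-systems: `Σ_c #c ≤ Σ_{ab = N} μ(a) dim S_k(Γ₀(b))` -/

section Count

/-- **`r_{1,N} = Σ_c #c ≤ Σ_{M ∣ N} #newforms0(M) = Σ_{ab = N} μ(a) · dim_ℂ S_k(Γ₀(b))`** (Pasten
2024, §7.1 p. 26: "`r_{D,M} = Σ_{m ∣ M} s(Dm)`" for `D = 1`, `M = N`, and "`r_{D,M} = Σ_c #c`", with
the classes `c` of systems of Hecke eigenvalues on `𝕋 = 𝕋_{1,N}` read as the minimal primes `P` of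
`𝕋 = anemicHeckeRing N k` and `#c = rank_ℤ(𝕋 ⧸ P)` as in `PastenSpectralDegree.lean`). Proof over
the tree: `Σ_P rank_ℤ(𝕋 ⧸ P) ≤ rank_ℤ 𝕋` (Part A) `≤ #{systems of the Atkin–Lehner eigenbasis}`
(Part B) `≤ #{(M, g) : M ∣ N, g ∈ newforms0 M}` (the system of `[α_d]_k g` is that of `g`)
`= Σ_{M ∣ N} #newforms0(M) = Σ_{ab = N} μ(a) dim S_k(Γ₀(b))` (Part C). Only the inequality is
proved (equality is multiplicity one / strong multiplicity one, not needed downstream).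
[cite: PastenShimura2024, §7.1 p. 26] -/
theorem sum_finrank_quotient_minimalPrimes_le_moebius_sum (N : ℕ) [NeZero N] (k : ℤ) :
    ((∑ P ∈ (finite_minimalPrimes_anemicHeckeRing N k).toFinset,
        Module.finrank ℤ (anemicHeckeRing N k ⧸ P) : ℕ) : ℤ) ≤
      ∑ x ∈ N.divisorsAntidiagonal, (ArithmeticFunction.moebius x.1 : ℤ) *
        (Module.finrank ℂ (CuspForm (Gamma0 x.2) k) : ℤ) := by
  classical
  haveI := finite_atkinLehnerIndex N
  haveI : Fintype (AtkinLehnerIndex N) := Fintype.ofFinite _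
  haveI : ∀ y : {y : AtkinLehnerIndex N // y.1.2 = 1}, Fintype ↥(newforms0 y.1.1.1 k) :=
    fun y ↦ (finite_newforms0_holds y.1.1.1 k).fintype
  -- the newform count `n(M) = #newforms0(M)` as a total function
  let n : ℕ → ℕ := fun M ↦ if h : M = 0 then 0 else @Nat.card ↥(@newforms0 M ⟨h⟩ k)
  have hn : ∀ (M : ℕ) [NeZero M], n M = Nat.card ↥(newforms0 M k) := fun M _ ↦ by
    simp only [n, dif_neg (NeZero.ne M)]
  -- Part A
  have hA := sum_finrank_quotient_minimalPrimes_le_finrank (N := N) (k := k)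
  -- Part B with the Atkin–Lehner eigenbasis
  let X : Finset (anemicHeckeRing N k → ℂ) := Finset.univ.image fun t : (Σ j : (Σ y :
      {y : AtkinLehnerIndex N // y.1.2 = 1}, ↥(newforms0 y.1.1.1 k)),
      {x : AtkinLehnerIndex N // x.1.1 = j.1.1.1.1}) ↦
        anemicEigenvalue (degeneracyMap0 t.1.1.1.1.1 N t.2.1.1.2 k t.1.2.1)
  have hB : Module.finrank ℤ (anemicHeckeRing N k) ≤ X.card :=
    finrank_anemicHeckeRing_le_card_systems _ (linearIndependent_degeneracyMap0_newforms N k)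
      (span_degeneracyMap0_newforms_eq_top N k) (isAnemicEigenvector_degeneracyMap0_newforms N k)
      X (fun t ↦ Finset.mem_image_of_mem _ (Finset.mem_univ t))
  -- Part C: the systems only depend on `(M, g)`
  let G : (Σ y : {y : AtkinLehnerIndex N // y.1.2 = 1}, ↥(newforms0 y.1.1.1 k)) →
      (anemicHeckeRing N k → ℂ) := fun j ↦ anemicEigenvalue (degeneracyMap0 j.1.1.1.1 N j.1.1.1.2 k j.2.1)
  have hXG : X ⊆ Finset.univ.image G := by
    intro χ hχ
    obtain ⟨t, -, rfl⟩ := Finset.mem_image.mp hχ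
    rw [anemicEigenvalue_degeneracyMap0_newforms_eq N k t]
    exact Finset.mem_image_of_mem G (Finset.mem_univ t.1)
  have hC : X.card ≤ ∑ M ∈ N.divisors, n M := by
    refine (Finset.card_le_card hXG).trans (Finset.card_image_le.trans ?_)
    rw [Finset.card_univ, ← Nat.card_eq_fintype_card, natCard_sigma_newforms0_eq_sum_divisors N k n hn]
  rw [← sum_divisors_card_newforms0_eq_moebius_sum N (NeZero.ne N) k n hn]
  exact_mod_cast hA.trans (hB.trans hC)

end Count

/-! ### Part D1. `Σ_{ab = N} μ(a) ψ(b) = N ∏_{p² ∣ N} (1 - p⁻²) ≤ N` for the index `ψ = gamma0Index` -/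

section IndexMoebius

open scoped ArithmeticFunction.Moebius

open ArithmeticFunction

/-- `ψ(1) = 1` for `ψ = gamma0Index`. [folklore] -/
theorem gamma0Index_one : gamma0Index 1 = 1 := by
  simp [gamma0Index]

/-- **`0 ≤ Σ_{ab = N} μ(a) ψ(b) ≤ N`** for `N ≥ 1`, where `ψ(L) = [SL₂(ℤ) : Γ₀(L)] = L ∏_{p ∣ L}(1 + 1/p)`
(`gamma0Index`): the Dirichlet convolution `μ ⋆ ψ` is multiplicative with
`(μ ⋆ ψ)(p) = (p + 1) - 1 = p` and `(μ ⋆ ψ)(p^a) = p^{a-1}(p + 1) - p^{a-2}(p + 1) = p^{a-2}(p² - 1)`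
for `a ≥ 2`, each in `[0, p^a]`; so `(μ ⋆ ψ)(N) = N ∏_{p² ∣ N}(1 - p⁻²)`. (This is the main term
`Σ_{m ∣ M} φ(m) = M`-type evaluation in Pasten 2024, §7.1 p. 26, here for the full index instead of
G. Martin's new part.) [folklore] -/
theorem moebius_mul_gamma0Index_le (N : ℕ) (hN : N ≠ 0) :
    0 ≤ ∑ x ∈ N.divisorsAntidiagonal, (μ x.1 : ℤ) * (gamma0Index x.2 : ℤ) ∧
      ∑ x ∈ N.divisorsAntidiagonal, (μ x.1 : ℤ) * (gamma0Index x.2 : ℤ) ≤ N := by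
  classical
  -- `ψ` as an arithmetic function
  let Ψ : ArithmeticFunction ℤ := ⟨fun m ↦ if m = 0 then 0 else (gamma0Index m : ℤ), if_pos rfl⟩
  have hΨ : ∀ m : ℕ, m ≠ 0 → Ψ m = gamma0Index m := fun m hm ↦ if_neg hm
  have hΨmult : Ψ.IsMultiplicative := by
    refine IsMultiplicative.iff_ne_zero.mpr ⟨?_, fun {m n} hm hn hmn ↦ ?_⟩
    · rw [hΨ 1 one_ne_zero, gamma0Index_one, Nat.cast_one]
    · rw [hΨ _ (mul_ne_zero hm hn), hΨ m hm, hΨ n hn, gamma0Index_mul hmn, Nat.cast_mul]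
  have hmult : (μ * Ψ).IsMultiplicative := isMultiplicative_moebius.mul hΨmult
  -- the sum is `(μ ⋆ ψ)(N)`
  have hsum : ∑ x ∈ N.divisorsAntidiagonal, (μ x.1 : ℤ) * (gamma0Index x.2 : ℤ) = (μ * Ψ) N := by
    rw [mul_apply]
    refine Finset.sum_congr rfl fun x hx ↦ ?_
    rw [hΨ x.2 (Nat.ne_zero_of_mem_divisorsAntidiagonal hx).2]
  -- values at prime powers
  have hpp : ∀ (p b : ℕ), p.Prime →
      0 ≤ (μ * Ψ) (p ^ (b + 1)) ∧ (μ * Ψ) (p ^ (b + 1)) ≤ (p : ℤ) ^ (b + 1) := by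
    intro p b hp
    have hp0 : 0 < p := hp.pos
    have hdiv : p ^ (b + 1) / p = p ^ b := by
      rw [pow_succ, Nat.mul_div_cancel _ hp0]
    have heval : (μ * Ψ) (p ^ (b + 1)) = (gamma0Index (p ^ (b + 1)) : ℤ) - gamma0Index (p ^ b) := by
      rw [mul_apply, Nat.sum_divisorsAntidiagonal (fun i j ↦ (μ i : ℤ) * Ψ j),
        Nat.sum_divisors_prime_pow hp, Finset.sum_range_succ', Finset.sum_range_succ']
      have hrest : ∑ i ∈ Finset.range b,
          (μ (p ^ (i + 1 + 1)) : ℤ) * Ψ (p ^ (b + 1) / p ^ (i + 1 + 1)) = 0 := by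
        refine Finset.sum_eq_zero fun i _ ↦ ?_
        rw [moebius_apply_prime_pow hp (by omega), if_neg (by omega), zero_mul]
      rw [hrest, zero_add]
      simp only [zero_add, pow_zero, Nat.div_one, pow_one, moebius_apply_one, one_mul,
        moebius_apply_prime hp, hdiv]
      rw [hΨ _ (pow_ne_zero _ hp.ne_zero), hΨ _ (pow_ne_zero _ hp.ne_zero)]
      ring
    rw [heval, gamma0Index_prime_pow hp (Nat.add_one_ne_zero b), Nat.add_sub_cancel]
    have hp1 : (1 : ℤ) ≤ p := by exact_mod_cast hp.one_lt.le
    rcases Nat.eq_zero_or_pos b with rfl | hb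
    · simp only [zero_add, pow_one, pow_zero, one_mul, gamma0Index_one, Nat.cast_add, Nat.cast_one]
      constructor <;> linarith
    · obtain ⟨c, rfl⟩ : ∃ c, b = c + 1 := Nat.exists_eq_add_one_of_ne_zero hb.ne'
      rw [gamma0Index_prime_pow hp (Nat.add_one_ne_zero c), Nat.add_sub_cancel]
      push_cast
      have hpc : (0 : ℤ) ≤ (p : ℤ) ^ c := by positivity
      have e1 : (p : ℤ) ^ (c + 1) * (p + 1) - (p : ℤ) ^ c * (p + 1) =
          (p : ℤ) ^ c * ((p + 1) * (p - 1)) := by ring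
      have e2 : (p : ℤ) ^ c * ((p + 1) * (p - 1)) = (p : ℤ) ^ (c + 1 + 1) - (p : ℤ) ^ c := by ring
      rw [e1]
      constructor
      · exact mul_nonneg hpc (mul_nonneg (by linarith) (by linarith))
      · rw [e2]
        linarith
  have hpp' : ∀ (p a : ℕ), p.Prime → a ≠ 0 →
      0 ≤ (μ * Ψ) (p ^ a) ∧ (μ * Ψ) (p ^ a) ≤ (p : ℤ) ^ a := by
    intro p a hp ha
    obtain ⟨b, rfl⟩ := Nat.exists_eq_add_one_of_ne_zero ha
    exact hpp p b hp
  -- multiplicativity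
  have hfac : ∀ p ∈ N.factorization.support, p.Prime ∧ N.factorization p ≠ 0 := fun p hp ↦
    ⟨Nat.prime_of_mem_primeFactors (Nat.support_factorization N ▸ hp), Finsupp.mem_support_iff.mp hp⟩
  have hprod : (μ * Ψ) N = ∏ p ∈ N.factorization.support, (μ * Ψ) (p ^ N.factorization p) := by
    rw [hmult.multiplicative_factorization _ hN, Finsupp.prod]
  have hNprod : (N : ℤ) = ∏ p ∈ N.factorization.support, (p : ℤ) ^ N.factorization p := by
    conv_lhs => rw [← Nat.prod_factorization_pow_eq_self hN]
    rw [Finsupp.prod, Nat.cast_prod]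
    simp only [Nat.cast_pow]
  rw [hsum, hprod]
  refine ⟨Finset.prod_nonneg fun p hp ↦ (hpp' p _ (hfac p hp).1 (hfac p hp).2).1, ?_⟩
  rw [hNprod]
  exact Finset.prod_le_prod (fun p hp ↦ (hpp' p _ (hfac p hp).1 (hfac p hp).2).1)
    fun p hp ↦ (hpp' p _ (hfac p hp).1 (hfac p hp).2).2

end IndexMoebius

/-! ### Part D2. Root counts modulo `N`: `ν₂(N) ≤ 2^{ω(N)}`, `ν₃(N) ≤ 3^{ω(N)}`, `ν_∞(N) ≤ d(N)√N` -/

section LocalRoots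

open _root_.Polynomial

/-- In `ZMod (p^e)` (`e ≥ 1`), an element with nonzero reduction modulo `p` is a unit. [folklore] -/
theorem isUnit_of_castHom_zmod_ne_zero {p e : ℕ} (hp : p.Prime) (he : e ≠ 0) {z : ZMod (p ^ e)}
    (hz : ZMod.castHom (dvd_pow_self p he) (ZMod p) z ≠ 0) : IsUnit z := by
  haveI : NeZero (p ^ e) := ⟨pow_ne_zero _ hp.ne_zero⟩
  rw [← ZMod.natCast_zmod_val z] at hz ⊢
  rw [map_natCast, Ne, ZMod.natCast_eq_zero_iff] at hz
  exact (ZMod.isUnit_natCast_iff_not_dvd_pow hp (Nat.pos_of_ne_zero he)).mpr hz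

/-- In `ZMod (p^e)`: if `u w = 0` and `u + w` is a unit then `u = 0` or `w = 0` (one of `u`, `w`
has nonzero reduction mod `p`, hence is a unit). [folklore] -/
theorem eq_zero_or_eq_zero_of_mul_eq_zero_of_isUnit_add {p e : ℕ} (hp : p.Prime) (he : e ≠ 0)
    {u w : ZMod (p ^ e)} (huw : u * w = 0) (hunit : IsUnit (u + w)) : u = 0 ∨ w = 0 := by
  haveI : Fact p.Prime := ⟨hp⟩
  have hsum : ZMod.castHom (dvd_pow_self p he) (ZMod p) u +
      ZMod.castHom (dvd_pow_self p he) (ZMod p) w ≠ 0 := by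
    rw [← map_add]
    exact (hunit.map _).ne_zero
  by_cases hu : ZMod.castHom (dvd_pow_self p he) (ZMod p) u = 0
  · rw [hu, zero_add] at hsum
    exact Or.inl ((isUnit_of_castHom_zmod_ne_zero hp he hsum).mul_left_eq_zero.mp huw)
  · exact Or.inr ((isUnit_of_castHom_zmod_ne_zero hp he hu).mul_right_eq_zero.mp huw)

/-- A type all of whose elements lie in `{a, b}` has at most two elements. [folklore] -/
theorem natCard_le_two_of_forall_eq_or_eq {α : Type*} (a b : α) (h : ∀ x : α, x = a ∨ x = b) :
    Nat.card α ≤ 2 := by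
  have hsurj : Function.Surjective (fun t : Bool ↦ if t then a else b) := fun x ↦ by
    rcases h x with rfl | rfl
    · exact ⟨true, rfl⟩
    · exact ⟨false, rfl⟩
  have hB : Nat.card Bool = 2 := by simp
  exact hB ▸ Nat.card_le_card_of_surjective _ hsurj

/-- A natural number coprime to `p` is a unit in `ZMod (p^e)`. [folklore] -/
theorem isUnit_natCast_zmod_prime_pow {p e m : ℕ} (hp : p.Prime) (he : e ≠ 0) (hm : ¬ p ∣ m) :
    IsUnit ((m : ℕ) : ZMod (p ^ e)) :=
  (ZMod.isUnit_natCast_iff_not_dvd_pow hp (Nat.pos_of_ne_zero he)).mpr hm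

/-- **`x² + 1 ≡ 0 (mod p^e)` has at most two solutions** (`p` prime, `e ≥ 1`): for odd `p` two
solutions `x, y` satisfy `(y - x)(y + x) = 0` with `(y - x) + (y + x) = 2y` a unit, so `y = ±x`;
for `p = 2`, `e = 1` there are two residues and for `e ≥ 2` no solutions (`x² + 1 ≢ 0 mod 4`).
[folklore] -/
theorem natCard_sq_add_one_zmod_prime_pow_le {p e : ℕ} (hp : p.Prime) (he : e ≠ 0) :
    Nat.card {x : ZMod (p ^ e) // x ^ 2 + 1 = 0} ≤ 2 := by
  haveI : NeZero (p ^ e) := ⟨pow_ne_zero _ hp.ne_zero⟩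
  by_cases h2 : p = 2
  · subst h2
    rcases Nat.lt_or_ge e 2 with he1 | he2
    · obtain rfl : e = 1 := by omega
      exact (Finite.card_subtype_le _).trans (by rw [Nat.card_zmod]; norm_num)
    · -- no solutions modulo `4`
      have h4 : 4 ∣ 2 ^ e := by
        obtain ⟨c, rfl⟩ := Nat.exists_eq_add_of_le he2
        exact ⟨2 ^ c, by rw [pow_add]; norm_num⟩
      haveI : IsEmpty {x : ZMod (2 ^ e) // x ^ 2 + 1 = 0} := ⟨fun ⟨x, hx⟩ ↦ by
        have h := congrArg (ZMod.castHom h4 (ZMod 4)) hx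
        rw [map_add, map_pow, map_one, map_zero] at h
        revert h
        generalize ZMod.castHom h4 (ZMod 4) x = y
        revert y
        decide⟩
      rw [Nat.card_of_isEmpty]
      exact Nat.zero_le _
  · -- `p` odd
    have h2unit : IsUnit (2 : ZMod (p ^ e)) := by
      have := isUnit_natCast_zmod_prime_pow (m := 2) hp he (fun h ↦ h2 ((Nat.prime_dvd_prime_iff_eq hp Nat.prime_two).mp h))
      simpa using this
    rcases isEmpty_or_nonempty {x : ZMod (p ^ e) // x ^ 2 + 1 = 0} with hE | ⟨⟨x₀, hx₀⟩⟩
    · rw [Nat.card_of_isEmpty]; exact Nat.zero_le _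
    refine natCard_le_two_of_forall_eq_or_eq ⟨x₀, hx₀⟩ ⟨-x₀, by linear_combination hx₀⟩ ?_
    rintro ⟨y, hy⟩
    have huw : (y - x₀) * (y + x₀) = 0 := by linear_combination hy - hx₀
    have hyunit : IsUnit y := IsUnit.of_mul_eq_one (-y) (by linear_combination -hy)
    have hunit : IsUnit ((y - x₀) + (y + x₀)) := by
      rw [show (y - x₀) + (y + x₀) = 2 * y by ring]
      exact h2unit.mul hyunit
    rcases eq_zero_or_eq_zero_of_mul_eq_zero_of_isUnit_add hp he huw hunit with h | h
    · exact Or.inl (Subtype.ext (sub_eq_zero.mp h))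
    · exact Or.inr (Subtype.ext (eq_neg_of_add_eq_zero_left h))

/-- **`x² + x + 1 ≡ 0 (mod p^e)` has at most three solutions** (`p` prime, `e ≥ 1`; in fact at
most two): for `p ≠ 3` two solutions `x, y` satisfy `(y - x)(y + x + 1) = 0` with
`(y + x + 1) - (y - x) = 2x + 1`, `(2x + 1)² = -3` a unit, so `y = x` or `y = -x - 1`; for `p = 3`,
`e = 1` there are three residues and for `e ≥ 2` no solutions (`x² + x + 1 ≢ 0 mod 9`).
[folklore] -/
theorem natCard_sq_add_self_add_one_zmod_prime_pow_le {p e : ℕ} (hp : p.Prime) (he : e ≠ 0) :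
    Nat.card {x : ZMod (p ^ e) // x ^ 2 + x + 1 = 0} ≤ 3 := by
  haveI : NeZero (p ^ e) := ⟨pow_ne_zero _ hp.ne_zero⟩
  by_cases h3 : p = 3
  · subst h3
    rcases Nat.lt_or_ge e 2 with he1 | he2
    · obtain rfl : e = 1 := by omega
      exact (Finite.card_subtype_le _).trans (by rw [Nat.card_zmod]; norm_num)
    · -- no solutions modulo `9`
      have h9 : 9 ∣ 3 ^ e := by
        obtain ⟨c, rfl⟩ := Nat.exists_eq_add_of_le he2
        exact ⟨3 ^ c, by rw [pow_add]; norm_num⟩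
      haveI : IsEmpty {x : ZMod (3 ^ e) // x ^ 2 + x + 1 = 0} := ⟨fun ⟨x, hx⟩ ↦ by
        have h := congrArg (ZMod.castHom h9 (ZMod 9)) hx
        rw [map_add, map_add, map_pow, map_one, map_zero] at h
        revert h
        generalize ZMod.castHom h9 (ZMod 9) x = y
        revert y
        decide⟩
      rw [Nat.card_of_isEmpty]
      exact Nat.zero_le _
  · -- `p ≠ 3`
    have h3unit : IsUnit (3 : ZMod (p ^ e)) := by
      have := isUnit_natCast_zmod_prime_pow (m := 3) hp he (fun h ↦ h3 ((Nat.prime_dvd_prime_iff_eq hp Nat.prime_three).mp h))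
      simpa using this
    rcases isEmpty_or_nonempty {x : ZMod (p ^ e) // x ^ 2 + x + 1 = 0} with hE | ⟨⟨x₀, hx₀⟩⟩
    · rw [Nat.card_of_isEmpty]; exact Nat.zero_le _
    refine (natCard_le_two_of_forall_eq_or_eq ⟨x₀, hx₀⟩ ⟨-x₀ - 1, by linear_combination hx₀⟩ ?_).trans
      (by norm_num)
    rintro ⟨y, hy⟩
    have huw : (-(y - x₀)) * (y + x₀ + 1) = 0 := by linear_combination hx₀ - hy
    have hsq : IsUnit ((2 * x₀ + 1) ^ 2) := by
      rw [show (2 * x₀ + 1) ^ 2 = -3 + 4 * (x₀ ^ 2 + x₀ + 1) by ring, hx₀, mul_zero, add_zero]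
      exact h3unit.neg
    have hunit : IsUnit (-(y - x₀) + (y + x₀ + 1)) := by
      rw [show -(y - x₀) + (y + x₀ + 1) = 2 * x₀ + 1 by ring]
      exact (isUnit_pow_iff two_ne_zero).mp hsq
    rcases eq_zero_or_eq_zero_of_mul_eq_zero_of_isUnit_add hp he huw hunit with h | h
    · exact Or.inl (Subtype.ext (sub_eq_zero.mp (neg_eq_zero.mp h)))
    · exact Or.inr (Subtype.ext (by linear_combination h))

end LocalRoots

section CRT

open _root_.Polynomial

/-- Ring maps commute with the evaluation of integer polynomials. [folklore] -/
theorem map_aeval_int {R S : Type*} [CommRing R] [CommRing S] (f : R →+* S) (x : R) (q : ℤ[X]) :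
    f (aeval x q) = aeval (f x) q := by
  rw [← RingHom.toIntAlgHom_apply f (aeval x q), ← aeval_algHom_apply, RingHom.toIntAlgHom_apply]

/-- **Chinese remainder theorem for root counts**: for coprime `m, n` and an integer polynomial
`q`, `#{x mod mn : q(x) = 0} = #{x mod m : q(x) = 0} · #{x mod n : q(x) = 0}`. [folklore] -/
theorem natCard_aeval_eq_zero_zmod_mul (q : ℤ[X]) {m n : ℕ} (h : m.Coprime n) :
    Nat.card {x : ZMod (m * n) // aeval x q = 0} =
      Nat.card {x : ZMod m // aeval x q = 0} * Nat.card {x : ZMod n // aeval x q = 0} := by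
  let e := ZMod.chineseRemainder h
  have he : ∀ x : ZMod (m * n), aeval x q = 0 ↔
      aeval (e.toEquiv x).1 q = 0 ∧ aeval (e.toEquiv x).2 q = 0 := by
    intro x
    change aeval x q = 0 ↔ aeval (e x).1 q = 0 ∧ aeval (e x).2 q = 0
    have h1 : aeval (e x).1 q = (e (aeval x q)).1 := by
      rw [show (e x).1 = RingHom.fst _ _ (e.toRingHom x) from rfl, ← map_aeval_int, ← map_aeval_int]
      rfl
    have h2 : aeval (e x).2 q = (e (aeval x q)).2 := by
      rw [show (e x).2 = RingHom.snd _ _ (e.toRingHom x) from rfl, ← map_aeval_int, ← map_aeval_int]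
      rfl
    rw [h1, h2]
    constructor
    · intro hx
      rw [hx, map_zero]
      exact ⟨rfl, rfl⟩
    · rintro ⟨hx1, hx2⟩
      exact (map_eq_zero_iff e e.injective).mp (Prod.ext hx1 hx2)
  rw [← Nat.card_prod]
  refine Nat.card_congr ((Equiv.subtypeEquiv (p := fun x : ZMod (m * n) ↦ aeval x q = 0)
    (q := fun y : ZMod m × ZMod n ↦ aeval y.1 q = 0 ∧ aeval y.2 q = 0) e.toEquiv he).trans ?_)
  exact Equiv.subtypeProdEquivProd (p := fun a : ZMod m ↦ aeval a q = 0) (q := fun b : ZMod n ↦ aeval b q = 0)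

/-- **Root counts are sub-multiplicative**: if `q(x) ≡ 0 (mod p^e)` has at most `B` solutions for
every prime power, then `#{x mod N : q(x) = 0} ≤ B^{ω(N)}` for every `N ≥ 1` (Chinese remainder
theorem). [folklore] -/
theorem natCard_aeval_eq_zero_zmod_le_pow (q : ℤ[X]) (B : ℕ)
    (hB : ∀ (p e : ℕ), p.Prime → e ≠ 0 → Nat.card {x : ZMod (p ^ e) // aeval x q = 0} ≤ B) :
    ∀ N : ℕ, N ≠ 0 → Nat.card {x : ZMod N // aeval x q = 0} ≤ B ^ N.primeFactors.card := by
  intro N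
  induction N using Nat.recOnPosPrimePosCoprime with
  | prime_pow p n hp hn =>
    intro _
    rw [Nat.primeFactors_prime_pow hn.ne' hp, Finset.card_singleton, pow_one]
    exact hB p n hp hn.ne'
  | zero => exact fun h ↦ (h rfl).elim
  | one =>
    intro _
    rw [Nat.primeFactors_one, Finset.card_empty, pow_zero]
    exact (Finite.card_subtype_le _).trans (by rw [Nat.card_zmod])
  | coprime a b ha hb hab iha ihb =>
    intro _
    rw [natCard_aeval_eq_zero_zmod_mul q hab, Nat.Coprime.primeFactors_mul hab,
      Finset.card_union_of_disjoint (Nat.Coprime.disjoint_primeFactors hab), pow_add]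
    exact Nat.mul_le_mul (iha (by omega)) (ihb (by omega))

end CRT

section NuBounds

open _root_.Polynomial

/-- **`ν₂(N) ≤ 2^{ω(N)}`** for `N ≥ 1`. [folklore] -/
theorem nu₂_le_two_pow_card_primeFactors (N : ℕ) (hN : N ≠ 0) :
    nu₂ N ≤ 2 ^ N.primeFactors.card := by
  have hconv : ∀ M : ℕ, Nat.card {x : ZMod M // x ^ 2 + 1 = 0} =
      Nat.card {x : ZMod M // aeval x (X ^ 2 + 1 : ℤ[X]) = 0} := fun M ↦
    Nat.card_congr (Equiv.subtypeEquivRight fun x ↦ by simp)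
  unfold nu₂
  rw [hconv]
  refine natCard_aeval_eq_zero_zmod_le_pow _ 2 (fun p e hp he ↦ ?_) N hN
  rw [← hconv]
  exact natCard_sq_add_one_zmod_prime_pow_le hp he

/-- **`ν₃(N) ≤ 3^{ω(N)}`** for `N ≥ 1`. [folklore] -/
theorem nu₃_le_three_pow_card_primeFactors (N : ℕ) (hN : N ≠ 0) :
    nu₃ N ≤ 3 ^ N.primeFactors.card := by
  have hconv : ∀ M : ℕ, Nat.card {x : ZMod M // x ^ 2 + x + 1 = 0} =
      Nat.card {x : ZMod M // aeval x (X ^ 2 + X + 1 : ℤ[X]) = 0} := fun M ↦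
    Nat.card_congr (Equiv.subtypeEquivRight fun x ↦ by simp)
  unfold nu₃
  rw [hconv]
  refine natCard_aeval_eq_zero_zmod_le_pow _ 3 (fun p e hp he ↦ ?_) N hN
  rw [← hconv]
  exact natCard_sq_add_self_add_one_zmod_prime_pow_le hp he

/-- **`ν₂(N) ≤ d(N)`** for `N ≥ 1`. [folklore] -/
theorem nu₂_le_card_divisors (N : ℕ) (hN : N ≠ 0) : nu₂ N ≤ N.divisors.card := by
  refine (nu₂_le_two_pow_card_primeFactors N hN).trans ?_
  -- `2^{ω(N)} ≤ d(N) = ∏ (e_p + 1)`, inlined: the tree's public copy of this statement is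
  -- `Literature.NumberTheory.DiophantineGeometry.SquarefulCount.two_pow_card_primeFactors_le_card_divisors`
  -- (`SquarefulSumsCountingTools.lean`, whose cone — `import Mathlib` + PNT — is too heavy here).
  rw [Nat.card_divisors hN]
  refine Finset.pow_card_le_prod _ _ _ fun p hp ↦ ?_
  have : N.factorization p ≠ 0 :=
    Finsupp.mem_support_iff.mp (by rwa [Nat.support_factorization])
  omega

/-- **`ν₃(N) ≤ d(N)²`** for `N ≥ 1` (`3^ω ≤ 4^ω = (2^ω)²`). [folklore] -/
theorem nu₃_le_card_divisors_sq (N : ℕ) (hN : N ≠ 0) : nu₃ N ≤ N.divisors.card ^ 2 := by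
  refine (nu₃_le_three_pow_card_primeFactors N hN).trans ?_
  -- `2^ω ≤ d`, inlined (public copy: `SquarefulCount.two_pow_card_primeFactors_le_card_divisors`)
  have h2 : 2 ^ N.primeFactors.card ≤ N.divisors.card := by
    rw [Nat.card_divisors hN]
    refine Finset.pow_card_le_prod _ _ _ fun p hp ↦ ?_
    have : N.factorization p ≠ 0 :=
      Finsupp.mem_support_iff.mp (by rwa [Nat.support_factorization])
    omega
  calc 3 ^ N.primeFactors.card ≤ 4 ^ N.primeFactors.card := Nat.pow_le_pow_left (by norm_num) _
    _ = (2 ^ N.primeFactors.card) ^ 2 := by rw [← pow_mul, mul_comm, pow_mul]; norm_num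
    _ ≤ N.divisors.card ^ 2 := Nat.pow_le_pow_left h2 2

/-- **`ν_∞(N) ≤ d(N) √N`**: `ν_∞(N) = Σ_{d ∣ N} φ(gcd(d, N/d))` and `gcd(d, N/d)² ≤ d · (N/d) = N`.
[folklore] -/
theorem nuInfty_le_card_divisors_mul_sqrt (N : ℕ) : nuInfty N ≤ N.divisors.card * Nat.sqrt N := by
  unfold nuInfty
  rw [← smul_eq_mul, ← Finset.sum_const]
  refine Finset.sum_le_sum fun d hd ↦ (Nat.totient_le _).trans ?_
  rw [Nat.le_sqrt', pow_two]
  have hdN : d ∣ N := Nat.dvd_of_mem_divisors hd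
  have h1 : Nat.gcd d (N / d) * Nat.gcd d (N / d) ∣ d * (N / d) :=
    Nat.mul_dvd_mul (Nat.gcd_dvd_left _ _) (Nat.gcd_dvd_right _ _)
  rw [Nat.mul_div_cancel' hdN] at h1
  have hN : N ≠ 0 := (Nat.mem_divisors.mp hd).2
  exact Nat.le_of_dvd (Nat.pos_of_ne_zero hN) h1

end NuBounds

/-! ### Part D3. `12 Σ_{ab = N} μ(a) dim S₂(Γ₀(b)) ≤ N + 25 d(N)³ √N` and the asymptotic form -/

section WeightTwo

open scoped ArithmeticFunction.Moebius

open ArithmeticFunction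

/-- **The genus formula in weight 2, integer form**: `12 dim S₂(Γ₀(L)) = 12 + ψ(L) - 3ν₂(L) -
4ν₃(L) - 6ν_∞(L)` for `L ≥ 1` (`finrank_cuspForm_two_eq_genusX0_holds`, `twelve_mul_genusX0_holds`;
Diamond–Shurman Thm. 3.1.1 and Thm. 3.5.1). [cite: DiamondShurman2005, Thm. 3.5.1] -/
theorem twelve_mul_finrank_cuspForm_two_eq_int (L : ℕ) [NeZero L] :
    12 * (Module.finrank ℂ (CuspForm (Gamma0 L) 2) : ℤ) =
      12 + (gamma0Index L : ℤ) - 3 * nu₂ L - 4 * nu₃ L - 6 * nuInfty L := by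
  have h1 : Module.finrank ℂ (CuspForm (Gamma0 L) 2) = genusX0 L := finrank_cuspForm_two_eq_genusX0_holds L
  have h2 : 12 * genusX0 L + 3 * nu₂ L + 4 * nu₃ L + 6 * nuInfty L = 12 + gamma0Index L :=
    twelve_mul_genusX0_holds L
  rw [h1]
  have h2' : (12 * genusX0 L + 3 * nu₂ L + 4 * nu₃ L + 6 * nuInfty L : ℕ) = ((12 + gamma0Index L : ℕ) : ℤ) := by
    exact_mod_cast h2
  push_cast at h2'
  linarith

/-- **`12 Σ_{ab = N} μ(a) dim S₂(Γ₀(b)) ≤ N + 25 d(N)³ ⌊√N⌋`** for `N ≥ 1`: by the genus formula,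
`12 dim S₂(Γ₀(b)) = ψ(b) + ρ(b)` with `|ρ(b)| ≤ 12 + 3ν₂(b) + 4ν₃(b) + 6ν_∞(b)`; the `ψ`-part
convolves to `≤ N` (`moebius_mul_gamma0Index_le`), and for `b ∣ N`, `ν₂(b) ≤ d(N)`,
`ν₃(b) ≤ d(N)²`, `ν_∞(b) ≤ d(N)√N`, summed over the `d(N)` divisors. (Pasten 2024, Prop. 7.1 has the
sharper `r_{1,N} ≤ N/12 + (7/12) d(N²) + 1` from G. Martin's closed form for `dim S₂(N)^{new}`; any
bound `N/12 + o(N)` serves the asymptotic clause of Thm 7.2.) [folklore] -/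
theorem twelve_mul_moebius_sum_finrank_cuspForm_two_le (N : ℕ) (hN : N ≠ 0) :
    12 * ∑ x ∈ N.divisorsAntidiagonal, (μ x.1 : ℤ) * (Module.finrank ℂ (CuspForm (Gamma0 x.2) 2) : ℤ) ≤
      (N : ℤ) + 25 * (N.divisors.card : ℤ) ^ 3 * Nat.sqrt N := by
  -- split `12 g(b) = ψ(b) + ρ(b)`
  have hsplit : ∀ x ∈ N.divisorsAntidiagonal,
      12 * ((μ x.1 : ℤ) * (Module.finrank ℂ (CuspForm (Gamma0 x.2) 2) : ℤ)) =
        (μ x.1 : ℤ) * (gamma0Index x.2 : ℤ) +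
          (μ x.1 : ℤ) * (12 - 3 * (nu₂ x.2 : ℤ) - 4 * nu₃ x.2 - 6 * nuInfty x.2) := by
    intro x hx
    haveI : NeZero x.2 := ⟨(Nat.ne_zero_of_mem_divisorsAntidiagonal hx).2⟩
    have h := twelve_mul_finrank_cuspForm_two_eq_int x.2
    linear_combination (μ x.1 : ℤ) * h
  rw [Finset.mul_sum, Finset.sum_congr rfl hsplit, Finset.sum_add_distrib]
  -- the `ψ`-part
  have hψ := (moebius_mul_gamma0Index_le N hN).2
  -- the `ρ`-part, termwise
  set d : ℤ := (N.divisors.card : ℤ) with hd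
  set s : ℤ := (Nat.sqrt N : ℤ) with hs
  have hd1 : 1 ≤ d := by
    rw [hd]; exact_mod_cast Finset.card_pos.mpr ⟨1, Nat.one_mem_divisors.mpr hN⟩
  have hs1 : 1 ≤ s := by
    rw [hs]; exact_mod_cast Nat.sqrt_pos.mpr (Nat.pos_of_ne_zero hN)
  have hρ : ∀ x ∈ N.divisorsAntidiagonal,
      (μ x.1 : ℤ) * (12 - 3 * (nu₂ x.2 : ℤ) - 4 * nu₃ x.2 - 6 * nuInfty x.2) ≤
        12 + 3 * d + 4 * d ^ 2 + 6 * d * s := by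
    intro x hx
    have hb0 : x.2 ≠ 0 := (Nat.ne_zero_of_mem_divisorsAntidiagonal hx).2
    have hbN : x.2 ∣ N := Nat.snd_mem_divisors_of_mem_antidiagonal hx |> Nat.dvd_of_mem_divisors
    have hdb : (x.2.divisors.card : ℤ) ≤ d := by
      rw [hd]; exact_mod_cast Finset.card_le_card (Nat.divisors_subset_of_dvd hN hbN)
    have hdb0 : (0 : ℤ) ≤ x.2.divisors.card := by positivity
    have h2 : (nu₂ x.2 : ℤ) ≤ d := le_trans (by exact_mod_cast nu₂_le_card_divisors x.2 hb0) hdb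
    have h3 : (nu₃ x.2 : ℤ) ≤ d ^ 2 :=
      le_trans (by exact_mod_cast nu₃_le_card_divisors_sq x.2 hb0) (pow_le_pow_left₀ hdb0 hdb 2)
    have hsb : (Nat.sqrt x.2 : ℤ) ≤ s := by
      rw [hs]; exact_mod_cast Nat.sqrt_le_sqrt (Nat.le_of_dvd (Nat.pos_of_ne_zero hN) hbN)
    have hi : (nuInfty x.2 : ℤ) ≤ d * s := by
      calc (nuInfty x.2 : ℤ) ≤ (x.2.divisors.card : ℤ) * Nat.sqrt x.2 := by
            exact_mod_cast nuInfty_le_card_divisors_mul_sqrt x.2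
        _ ≤ d * s := mul_le_mul hdb hsb (by positivity) (by linarith)
    have h20 : (0 : ℤ) ≤ nu₂ x.2 := by positivity
    have h30 : (0 : ℤ) ≤ nu₃ x.2 := by positivity
    have hi0 : (0 : ℤ) ≤ nuInfty x.2 := by positivity
    -- `μ ρ ≤ |ρ| ≤ 12 + 3ν₂ + 4ν₃ + 6ν_∞`
    have hμ : |(μ x.1 : ℤ)| ≤ 1 := abs_moebius_le_one
    have hρabs : |(12 - 3 * (nu₂ x.2 : ℤ) - 4 * nu₃ x.2 - 6 * nuInfty x.2)| ≤
        12 + 3 * nu₂ x.2 + 4 * nu₃ x.2 + 6 * nuInfty x.2 := by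
      rw [abs_le]; constructor <;> linarith
    calc (μ x.1 : ℤ) * (12 - 3 * (nu₂ x.2 : ℤ) - 4 * nu₃ x.2 - 6 * nuInfty x.2)
        ≤ |(μ x.1 : ℤ) * (12 - 3 * (nu₂ x.2 : ℤ) - 4 * nu₃ x.2 - 6 * nuInfty x.2)| := le_abs_self _
      _ = |(μ x.1 : ℤ)| * |(12 - 3 * (nu₂ x.2 : ℤ) - 4 * nu₃ x.2 - 6 * nuInfty x.2)| := abs_mul _ _
      _ ≤ 1 * (12 + 3 * nu₂ x.2 + 4 * nu₃ x.2 + 6 * nuInfty x.2) :=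
          mul_le_mul hμ hρabs (abs_nonneg _) zero_le_one
      _ ≤ 12 + 3 * d + 4 * d ^ 2 + 6 * d * s := by nlinarith
  have hρsum : ∑ x ∈ N.divisorsAntidiagonal,
      (μ x.1 : ℤ) * (12 - 3 * (nu₂ x.2 : ℤ) - 4 * nu₃ x.2 - 6 * nuInfty x.2) ≤
        d * (12 + 3 * d + 4 * d ^ 2 + 6 * d * s) := by
    refine (Finset.sum_le_sum hρ).trans ?_
    rw [Finset.sum_const, nsmul_eq_mul, ← Nat.map_div_right_divisors, Finset.card_map, hd]
  have hfin : d * (12 + 3 * d + 4 * d ^ 2 + 6 * d * s) ≤ 25 * d ^ 3 * s := by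
    have h1 : 12 ≤ 12 * d ^ 2 * s := by nlinarith
    have h2 : 3 * d ≤ 3 * d ^ 2 * s := by nlinarith
    have h3 : 4 * d ^ 2 ≤ 4 * d ^ 2 * s := by nlinarith
    have h4 : 6 * d * s ≤ 6 * d ^ 2 * s := by nlinarith
    nlinarith
  linarith

/-- **`Σ_{ab = N} μ(a) dim S₂(Γ₀(b)) ≤ N/12 + (25/12) d(N)³ √N`** (real form). [folklore] -/
theorem moebius_sum_finrank_cuspForm_two_le (N : ℕ) (hN : N ≠ 0) :
    (∑ x ∈ N.divisorsAntidiagonal, (μ x.1 : ℤ) * (Module.finrank ℂ (CuspForm (Gamma0 x.2) 2) : ℤ) : ℝ) ≤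
      (N : ℝ) / 12 + 25 / 12 * (N.divisors.card : ℝ) ^ 3 * Real.sqrt N := by
  have h := twelve_mul_moebius_sum_finrank_cuspForm_two_le N hN
  have h' : (12 : ℝ) * (∑ x ∈ N.divisorsAntidiagonal,
      (μ x.1 : ℤ) * (Module.finrank ℂ (CuspForm (Gamma0 x.2) 2) : ℤ) : ℝ) ≤
        (N : ℝ) + 25 * (N.divisors.card : ℝ) ^ 3 * (Nat.sqrt N : ℝ) := by
    exact_mod_cast h
  have hsq : (Nat.sqrt N : ℝ) ≤ Real.sqrt N := Real.nat_sqrt_le_real_sqrt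
  have hd0 : (0 : ℝ) ≤ 25 * (N.divisors.card : ℝ) ^ 3 := by positivity
  nlinarith [mul_le_mul_of_nonneg_left hsq hd0]

/-- **`Σ_{ab = N} μ(a) dim S₂(Γ₀(b)) ≤ (1/12 + ε) N` for `N ≫_ε 1`** (the divisor bound
`d(N) ≪ N^{1/12}` makes the error `O(N^{3/4})`). This is the asymptotic form
"`r_{D,M} < (1/12 + ε) φ(D) M` for `N ≫_ε 1`" of Pasten's Prop. 7.1 (2024, p. 26), `D = 1`, for the
dimension side of the count. [cite: PastenShimura2024, Prop. 7.1 (p. 26)] -/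
theorem exists_moebius_sum_finrank_cuspForm_two_le {ε : ℝ} (hε : 0 < ε) :
    ∃ N₁ : ℕ, ∀ N : ℕ, N₁ ≤ N →
      (∑ x ∈ N.divisorsAntidiagonal,
          (μ x.1 : ℤ) * (Module.finrank ℂ (CuspForm (Gamma0 x.2) 2) : ℤ) : ℝ) ≤ (1 / 12 + ε) * N := by
  obtain ⟨C, hC1, hC⟩ := Sieve.exists_card_divisors_le_mul_rpow' (ε := 1 / 12) (by norm_num)
  -- threshold: `(25/12) C³ N^{3/4} ≤ ε N` once `N^{1/4} ≥ 25 C³/(12 ε)`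
  refine ⟨max 1 ⌈(25 * C ^ 3 / (12 * ε)) ^ 4⌉₊, fun N hN ↦ ?_⟩
  have hN1 : 1 ≤ N := le_trans (le_max_left _ _) hN
  have hN0 : N ≠ 0 := by omega
  have hNr : (1 : ℝ) ≤ N := by exact_mod_cast hN1
  have hNpos : (0 : ℝ) < N := by linarith
  have hC0 : 0 ≤ C := le_trans zero_le_one hC1
  refine (moebius_sum_finrank_cuspForm_two_le N hN0).trans ?_
  -- `d(N)³ √N ≤ C³ N^{1/4} √N = C³ N^{3/4}`
  have hd : (N.divisors.card : ℝ) ≤ C * (N : ℝ) ^ (1 / 12 : ℝ) := hC N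
  have hd3 : (N.divisors.card : ℝ) ^ 3 ≤ C ^ 3 * (N : ℝ) ^ (1 / 4 : ℝ) := by
    calc (N.divisors.card : ℝ) ^ 3 ≤ (C * (N : ℝ) ^ (1 / 12 : ℝ)) ^ 3 :=
          pow_le_pow_left₀ (by positivity) hd 3
      _ = C ^ 3 * ((N : ℝ) ^ (1 / 12 : ℝ)) ^ 3 := by ring
      _ = C ^ 3 * (N : ℝ) ^ (1 / 4 : ℝ) := by
          rw [← Real.rpow_natCast ((N : ℝ) ^ (1 / 12 : ℝ)) 3, ← Real.rpow_mul hNpos.le]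
          norm_num
  -- `N^{1/4} ≥ 25 C³ / (12 ε)`
  have hq : 25 * C ^ 3 / (12 * ε) ≤ (N : ℝ) ^ (1 / 4 : ℝ) := by
    have h1 : (25 * C ^ 3 / (12 * ε)) ^ 4 ≤ N :=
      le_trans (Nat.le_ceil _) (by exact_mod_cast le_trans (le_max_right _ _) hN)
    have hpos : 0 ≤ 25 * C ^ 3 / (12 * ε) := by positivity
    calc 25 * C ^ 3 / (12 * ε) = (((25 * C ^ 3 / (12 * ε)) ^ 4) ^ (1 / 4 : ℝ)) := by
          rw [← Real.rpow_natCast _ 4, ← Real.rpow_mul hpos]; norm_num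
      _ ≤ (N : ℝ) ^ (1 / 4 : ℝ) := Real.rpow_le_rpow (by positivity) h1 (by norm_num)
  -- combine: `(25/12) d³ √N ≤ (25/12) C³ N^{1/4} √N ≤ ε N^{1/4} N^{1/4} √N · ... = ε N`
  have h14 : (0 : ℝ) ≤ (N : ℝ) ^ (1 / 4 : ℝ) := by positivity
  have hsqrt : Real.sqrt N = (N : ℝ) ^ (1 / 4 : ℝ) * (N : ℝ) ^ (1 / 4 : ℝ) := by
    rw [← Real.rpow_add hNpos, Real.sqrt_eq_rpow]; norm_num
  have hN34 : (N : ℝ) ^ (1 / 4 : ℝ) * Real.sqrt N * (N : ℝ) ^ (1 / 4 : ℝ) = N := by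
    rw [hsqrt, show (N : ℝ) ^ (1 / 4 : ℝ) * ((N : ℝ) ^ (1 / 4 : ℝ) * (N : ℝ) ^ (1 / 4 : ℝ)) *
        (N : ℝ) ^ (1 / 4 : ℝ) = ((N : ℝ) ^ (1 / 4 : ℝ)) ^ 4 by ring,
      ← Real.rpow_natCast _ 4, ← Real.rpow_mul hNpos.le]
    norm_num
  have hkey : 25 / 12 * (N.divisors.card : ℝ) ^ 3 * Real.sqrt N ≤ ε * N := by
    have e1 : 25 / 12 * (C ^ 3 * (N : ℝ) ^ (1 / 4 : ℝ)) * Real.sqrt N =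
        (25 * C ^ 3 / (12 * ε)) * ε * ((N : ℝ) ^ (1 / 4 : ℝ) * Real.sqrt N) := by
      field_simp
    calc 25 / 12 * (N.divisors.card : ℝ) ^ 3 * Real.sqrt N
        ≤ 25 / 12 * (C ^ 3 * (N : ℝ) ^ (1 / 4 : ℝ)) * Real.sqrt N :=
          mul_le_mul_of_nonneg_right (mul_le_mul_of_nonneg_left hd3 (by norm_num)) (Real.sqrt_nonneg _)
      _ = (25 * C ^ 3 / (12 * ε)) * ε * ((N : ℝ) ^ (1 / 4 : ℝ) * Real.sqrt N) := e1
      _ ≤ (N : ℝ) ^ (1 / 4 : ℝ) * ε * ((N : ℝ) ^ (1 / 4 : ℝ) * Real.sqrt N) :=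
          mul_le_mul_of_nonneg_right (mul_le_mul_of_nonneg_right hq hε.le) (by positivity)
      _ = ε * ((N : ℝ) ^ (1 / 4 : ℝ) * Real.sqrt N * (N : ℝ) ^ (1 / 4 : ℝ)) := by ring
      _ = ε * N := by rw [hN34]
  calc (N : ℝ) / 12 + 25 / 12 * (N.divisors.card : ℝ) ^ 3 * Real.sqrt N ≤ N / 12 + ε * N := by linarith
    _ = (1 / 12 + ε) * N := by ring

end WeightTwo

/-! ### Weight 2: `Σ_c #c ≤ N/12 + (25/12) d(N)³ √N ≤ (1/12 + ε) N` -/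

section CountWeightTwo

/-- **Pasten's Prop. 7.1, asymptotic content, over the tree (weight 2)**:
`Σ_c #c = Σ_{P minimal} rank_ℤ(𝕋_{1,N} ⧸ P) ≤ N/12 + (25/12) d(N)³ √N` for every `N ≥ 1`
(Pasten 2024, Prop. 7.1 p. 26 has `r_{1,N} ≤ N/12 + (7/12) d(N²) + 1`).
[cite: PastenShimura2024, Prop. 7.1 (p. 26)] -/
theorem sum_finrank_quotient_minimalPrimes_two_le (N : ℕ) [NeZero N] :
    ((∑ P ∈ (finite_minimalPrimes_anemicHeckeRing N 2).toFinset,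
        Module.finrank ℤ (anemicHeckeRing N 2 ⧸ P) : ℕ) : ℝ) ≤
      (N : ℝ) / 12 + 25 / 12 * (N.divisors.card : ℝ) ^ 3 * Real.sqrt N := by
  have h1 := sum_finrank_quotient_minimalPrimes_le_moebius_sum N 2
  have h1' : ((∑ P ∈ (finite_minimalPrimes_anemicHeckeRing N 2).toFinset,
      Module.finrank ℤ (anemicHeckeRing N 2 ⧸ P) : ℕ) : ℝ) ≤
      (∑ x ∈ N.divisorsAntidiagonal, (ArithmeticFunction.moebius x.1 : ℤ) *
        (Module.finrank ℂ (CuspForm (Gamma0 x.2) 2) : ℤ) : ℝ) := by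
    exact_mod_cast h1
  exact h1'.trans (moebius_sum_finrank_cuspForm_two_le N (NeZero.ne N))

/-- **Pasten's Prop. 7.1 in the asymptotic form used by the proof of Thm 7.2, over the tree**:
for every `ε > 0`, `Σ_c #c ≤ (1/12 + ε) N` for `N ≥ N₁(ε)` ("given `ε > 0`, for `N ≫_ε 1` with an
effective implicit constant, we have `r_{D,M} < (1/12 + ε) φ(D) M`", `D = 1`, `M = N`).
[cite: PastenShimura2024, Prop. 7.1 (p. 26)] -/
theorem exists_sum_finrank_quotient_minimalPrimes_two_le {ε : ℝ} (hε : 0 < ε) :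
    ∃ N₁ : ℕ, ∀ (N : ℕ) [NeZero N], N₁ ≤ N →
      ((∑ P ∈ (finite_minimalPrimes_anemicHeckeRing N 2).toFinset,
          Module.finrank ℤ (anemicHeckeRing N 2 ⧸ P) : ℕ) : ℝ) ≤ (1 / 12 + ε) * N := by
  obtain ⟨N₁, hN₁⟩ := exists_moebius_sum_finrank_cuspForm_two_le hε
  refine ⟨N₁, fun N _ hN ↦ ?_⟩
  have h1 := sum_finrank_quotient_minimalPrimes_le_moebius_sum N 2
  have h1' : ((∑ P ∈ (finite_minimalPrimes_anemicHeckeRing N 2).toFinset,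
      Module.finrank ℤ (anemicHeckeRing N 2 ⧸ P) : ℕ) : ℝ) ≤
      (∑ x ∈ N.divisorsAntidiagonal, (ArithmeticFunction.moebius x.1 : ℤ) *
        (Module.finrank ℂ (CuspForm (Gamma0 x.2) 2) : ℤ) : ℝ) := by
    exact_mod_cast h1
  exact h1'.trans (hN₁ N hN)

end CountWeightTwo

end Literature.NumberTheory.EllipticCurves.ModularForms

/-! ### Part E. Thm 7.5 (asymptotic clause) from modularity and Murty's Lemma 11 -/

namespace Literature.NumberTheory.EllipticCurves

open ModularForms WeierstrassCurve

namespace Pasten2024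

variable {N : ℕ} {W : WeierstrassCurve ℚ}

/-- **Thm 7.2, asymptotic clause (`D = 1`, `M = N`), from Thm 5.5, the weight-2 Ramanujan bound,
Murty's Lemma 11 and an ASYMPTOTIC count of eigen-systems.** As
`log_modularDegree_lt_of_thm_5_5_asymptotic`, with hypothesis (iv) (Prop 7.1 in the explicit shape
`Σ_{c ≠ [χ₀]} #c ≤ N/12 + (7/12) d(N²)`) weakened to what the proof uses: for every `κ > 0`,
`Σ_{c ≠ [χ₀]} #c ≤ (1/12 + κ) N` for `N ≥ N₂(κ)` (`hrA`; Pasten 2024, Prop 7.1, second display: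
"given `ε > 0`, for `N ≫_ε 1` … `r_{D,M} < (1/12 + ε) φ(D) M`"). This hypothesis is DISCHARGED over
the tree in `PastenEigenSystemCountProofs` (`exists_sum_finrank_quotient_minimalPrimes_two_le`).
[cite: PastenShimura2024, Thm. 7.2 (asymptotic clause) and its proof, p. 26]
[cite: Murty1999CongruencePrimes, §6 Lemma 11] -/
theorem log_modularDegree_lt_of_thm_5_5_asymptotic' (h55 : PastenShimura2024_thm_5_5)
    (h2 : ∀ (N : ℕ) [NeZero N] (p : ℕ) [NeZero p], p.Prime → ¬ p ∣ N → ∀ μ : ℂ,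
      Module.End.HasEigenvalue (heckeT (Gamma0 N) 2 p) μ → ‖μ‖ ≤ 2 * Real.sqrt p)
    (hMurty : ∀ ε : ℝ, 0 < ε → ∃ C : ℝ, ∀ (N M : ℕ) [NeZero N] [NeZero M], M ∣ N →
      ∀ (f : CuspForm (Gamma0 N) 2) (g : CuspForm (Gamma0 M) 2), IsNewform0 f → IsNewform0 g →
        (∃ n : ℕ, n.Coprime N ∧ (qExpansion 1 ⇑f).coeff n ≠ (qExpansion 1 ⇑g).coeff n) →
          ∃ n : ℕ, n.Coprime N ∧ (n : ℝ) ≤ C * (N : ℝ) ^ (1 + ε) ∧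
            (qExpansion 1 ⇑f).coeff n ≠ (qExpansion 1 ⇑g).coeff n)
    (hrA : ∀ κ : ℝ, 0 < κ → ∃ N₂ : ℕ, ∀ (N : ℕ) [NeZero N] (W : WeierstrassCurve ℚ) [W.IsElliptic]
      (D : ModularParametrizationData W N), N₂ ≤ N →
      (∑ P ∈ (finite_minimalPrimes_anemicHeckeRing N 2).toFinset.erase (eigenIdeal D.f),
          (Module.finrank ℤ (anemicHeckeRing N 2 ⧸ P) : ℝ)) ≤ (1 / 12 + κ) * N)
    {ε : ℝ} (hε : 0 < ε) :
    ∃ N₁ : ℕ, ∀ (N : ℕ) [NeZero N] (W : WeierstrassCurve ℚ) [W.IsElliptic]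
      (D : ModularParametrizationData W N),
      (∀ (W' : WeierstrassCurve ℚ) [W'.IsElliptic] (D' : ModularParametrizationData W' N),
          D'.f = D.f → D.modularDegree ≤ D'.modularDegree) →
        N₁ ≤ N → Real.log (D.modularDegree : ℝ) < (1 / 24 + ε) * (N : ℝ) * Real.log N := by
  -- the parameter `κ = min(ε/3, 1)` for both inputs, the constant `C ≥ 1`, the thresholds
  set κ : ℝ := min (ε / 3) 1 with hκ_def
  have hκ : 0 < κ := lt_min (by positivity) one_pos
  have hκ1 : κ ≤ 1 := min_le_right _ _
  have hκ3 : κ ≤ ε / 3 := min_le_left _ _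
  obtain ⟨C₀, hC₀⟩ := hMurty κ hκ
  set C : ℝ := max C₀ 1 with hC_def
  have hC1 : 1 ≤ C := le_max_right _ _
  obtain ⟨N₂, hN₂⟩ := hrA κ hκ
  set K : ℝ := (1 / 12 + κ) * (Real.log 4 + Real.log C / 2) with hK_def
  obtain ⟨M₀, hM₀⟩ := exists_mul_le_mul_mul_log (ε := ε / 8) (by positivity) K
  refine ⟨max N₂ M₀, fun N _ W _ D hmin hN => ?_⟩
  have hN₂N : N₂ ≤ N := le_trans (le_max_left _ _) hN
  have hM₀N : M₀ ≤ N := le_trans (le_max_right _ _) hN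
  have h11 : 11 ≤ N := eleven_le_level D
  have hNpos : (0 : ℝ) < N := by exact_mod_cast (show 0 < N by omega)
  have hlogN : 0 < Real.log N := Real.log_pos (by exact_mod_cast (show 1 < N by omega))
  -- Murty's bound at level `N` with the constant `C ≥ C₀`: `X = C N^{1+κ}`
  have hX : ∀ (M : ℕ) [NeZero M], M ∣ N →
      ∀ (f : CuspForm (Gamma0 N) 2) (g : CuspForm (Gamma0 M) 2), IsNewform0 f → IsNewform0 g →
        (∃ n : ℕ, n.Coprime N ∧ (qExpansion 1 ⇑f).coeff n ≠ (qExpansion 1 ⇑g).coeff n) →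
          ∃ n : ℕ, n.Coprime N ∧ (n : ℝ) ≤ C * (N : ℝ) ^ (1 + κ) ∧
            (qExpansion 1 ⇑f).coeff n ≠ (qExpansion 1 ⇑g).coeff n := by
    intro M _ hM f g hf hg hex
    obtain ⟨n, hn, hnC, hne⟩ := hC₀ N M hM f g hf hg hex
    exact ⟨n, hn, hnC.trans (mul_le_mul_of_nonneg_right (le_max_left _ _) (by positivity)), hne⟩
  have hB := log_modularDegree_le_card_mul_of_distinguishingIndex h55 h2 hX D hmin
  have hlogX : Real.log (C * (N : ℝ) ^ (1 + κ)) = Real.log C + (1 + κ) * Real.log N := by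
    rw [Real.log_mul (by positivity) (by positivity), Real.log_rpow hNpos]
  rw [hlogX] at hB
  -- the count: `Σ #c ≤ (1/12 + κ) N`
  have hS := hN₂ N W D hN₂N
  have hbr : 0 ≤ Real.log 4 + (Real.log C + (1 + κ) * Real.log N) / 2 := by
    have h4 : 0 ≤ Real.log 4 := Real.log_nonneg (by norm_num)
    have hC' : 0 ≤ Real.log C := Real.log_nonneg hC1
    have h3 : 0 ≤ (1 + κ) * Real.log N := mul_nonneg (by linarith) hlogN.le
    linarith
  have hmain : Real.log (D.modularDegree : ℝ) ≤
      ((1 / 12 + κ) * N) * (Real.log 4 + (Real.log C + (1 + κ) * Real.log N) / 2) :=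
    hB.trans (mul_le_mul_of_nonneg_right hS hbr)
  have hexp : ((1 / 12 + κ) * N) * (Real.log 4 + (Real.log C + (1 + κ) * Real.log N) / 2) =
      (1 / 12 + κ) * (1 + κ) / 2 * ((N : ℝ) * Real.log N) + K * N := by
    rw [hK_def]; ring
  have hKN := hM₀ N hM₀N
  have hsq : κ * κ ≤ κ := by nlinarith
  have hcoef : (1 / 12 + κ) * (1 + κ) / 2 ≤ 1 / 24 + 25 * ε / 72 := by nlinarith
  have hNlogN : 0 < (N : ℝ) * Real.log N := mul_pos hNpos hlogN
  have hεX : 0 < ε * ((N : ℝ) * Real.log N) := mul_pos hε hNlogN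
  calc Real.log (D.modularDegree : ℝ)
      ≤ (1 / 12 + κ) * (1 + κ) / 2 * ((N : ℝ) * Real.log N) + K * N := by rw [← hexp]; exact hmain
    _ ≤ (1 / 24 + 25 * ε / 72) * ((N : ℝ) * Real.log N) + ε / 8 * N * Real.log N :=
        add_le_add (mul_le_mul_of_nonneg_right hcoef hNlogN.le) hKN
    _ = (1 / 24 + ε) * N * Real.log N - 19 / 36 * (ε * ((N : ℝ) * Real.log N)) := by ring
    _ < (1 / 24 + ε) * N * Real.log N := by linarith

/-- **The count of eigen-systems other than `[χ₀]` is asymptotically `≤ (1/12 + κ) N`** — the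
discharge of hypothesis `hrA` over the tree: `Σ_{c ≠ [χ₀]} #c ≤ Σ_c #c ≤ Σ_{ab = N} μ(a) dim S₂(Γ₀(b))
≤ N/12 + O(d(N)³ √N)` (`PastenEigenSystemCountProofs`). [cite: PastenShimura2024, Prop. 7.1 (p. 26)] -/
theorem exists_sum_erase_finrank_quotient_le {κ : ℝ} (hκ : 0 < κ) :
    ∃ N₂ : ℕ, ∀ (N : ℕ) [NeZero N] (W : WeierstrassCurve ℚ) [W.IsElliptic]
      (D : ModularParametrizationData W N), N₂ ≤ N →
      (∑ P ∈ (finite_minimalPrimes_anemicHeckeRing N 2).toFinset.erase (eigenIdeal D.f),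
          (Module.finrank ℤ (anemicHeckeRing N 2 ⧸ P) : ℝ)) ≤ (1 / 12 + κ) * N := by
  obtain ⟨N₂, hN₂⟩ := exists_sum_finrank_quotient_minimalPrimes_two_le hκ
  refine ⟨N₂, fun N _ W _ D hN ↦ le_trans ?_ (hN₂ N hN)⟩
  rw [Nat.cast_sum]
  exact Finset.sum_le_sum_of_subset_of_nonneg (Finset.erase_subset _ _) fun _ _ _ ↦ Nat.cast_nonneg _

end Pasten2024

open Pasten2024

/-- **Pasten, Thm 7.5 (asymptotic discriminant clause) from modularity, Mazur–Kenku, Thm 5.5, the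
weight-2 Ramanujan bound and Murty's Lemma 11** — Prop 7.1 no longer a hypothesis: the count of
eigen-systems is proved over the tree (`PastenEigenSystemCountProofs`).
[cite: PastenShimura2024, Theorem 7.5 (proof, §7.4 p. 27) with Thm 7.2 (proof, p. 26)]
[cite: Murty1999CongruencePrimes, §6 Lemma 11] -/
theorem pasten_thm_7_5_of_modularity_of_murtyLemma_of_weight_two_bound
    (hmod : nonempty_modularParametrizationData)
    (h163 : PastenShimura2024_minimalDegree_le_163_mul)
    (h55 : PastenShimura2024_thm_5_5)
    (h2 : ∀ (N : ℕ) [NeZero N] (p : ℕ) [NeZero p], p.Prime → ¬ p ∣ N → ∀ μ : ℂ,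
      Module.End.HasEigenvalue (heckeT (Gamma0 N) 2 p) μ → ‖μ‖ ≤ 2 * Real.sqrt p)
    (hMurty : ∀ ε : ℝ, 0 < ε → ∃ C : ℝ, ∀ (N M : ℕ) [NeZero N] [NeZero M], M ∣ N →
      ∀ (f : CuspForm (Gamma0 N) 2) (g : CuspForm (Gamma0 M) 2), IsNewform0 f → IsNewform0 g →
        (∃ n : ℕ, n.Coprime N ∧ (qExpansion 1 ⇑f).coeff n ≠ (qExpansion 1 ⇑g).coeff n) →
          ∃ n : ℕ, n.Coprime N ∧ (n : ℝ) ≤ C * (N : ℝ) ^ (1 + ε) ∧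
            (qExpansion 1 ⇑f).coeff n ≠ (qExpansion 1 ⇑g).coeff n) :
    pasten_thm_7_5 :=
  pasten_thm_7_5_of_modularity_of_optimalDegreeBound hmod h163
    fun _ hε => log_modularDegree_lt_of_thm_5_5_asymptotic' h55 h2 hMurty
      (fun _ hκ ↦ exists_sum_erase_finrank_quotient_le hκ) hε

/-- **Pasten, Thm 7.5 (asymptotic discriminant clause: `log|Δ_E| < (1/4 + ε) N log N` for
`N ≫_ε 1`) from the named facts of the tree and Murty's Lemma 11.** Of the printed proof's inputs,
(i) the Modularity Theorem with integral Manin constant (`nonempty_modularParametrizationData`),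
(ii) Mazur–Kenku (`PastenShimura2024_minimalDegree_le_163_mul`), (iii) Thm 5.5
(`PastenShimura2024_thm_5_5`) and (iv) Deligne's bound (`Deligne1974_heckeT_eigenvalue_norm_le`,
weight-2 case) are named facts of the tree, and (v) Murty's Lemma 11 (`hMurty`, "`n_c ≪_ε N^{1+ε}`"
as used on p. 26) is the only un-vendored statement; Prop 7.1 (the count of eigen-systems),
Silverman's and Frey–Zagier's formulas, the trivial Petersson bound, the size of `η` from a
distinguishing prime and all the bookkeeping are theorems of the tree.
[cite: PastenShimura2024, Theorem 7.5 (proof, §7.4 p. 27) with Thm 7.2 (proof, p. 26)]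
[cite: Deligne1974, Thm. 8.2] [cite: Murty1999CongruencePrimes, §6 Lemma 11] -/
theorem pasten_thm_7_5_of_modularity_of_murtyLemma
    (hmod : nonempty_modularParametrizationData)
    (h163 : PastenShimura2024_minimalDegree_le_163_mul)
    (h55 : PastenShimura2024_thm_5_5)
    (hDel : Deligne1974_heckeT_eigenvalue_norm_le)
    (hMurty : ∀ ε : ℝ, 0 < ε → ∃ C : ℝ, ∀ (N M : ℕ) [NeZero N] [NeZero M], M ∣ N →
      ∀ (f : CuspForm (Gamma0 N) 2) (g : CuspForm (Gamma0 M) 2), IsNewform0 f → IsNewform0 g →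
        (∃ n : ℕ, n.Coprime N ∧ (qExpansion 1 ⇑f).coeff n ≠ (qExpansion 1 ⇑g).coeff n) →
          ∃ n : ℕ, n.Coprime N ∧ (n : ℝ) ≤ C * (N : ℝ) ^ (1 + ε) ∧
            (qExpansion 1 ⇑f).coeff n ≠ (qExpansion 1 ⇑g).coeff n) :
    pasten_thm_7_5 :=
  pasten_thm_7_5_of_modularity_of_murtyLemma_of_weight_two_bound hmod h163 h55
    (fun N _ p _ hp hpN μ hμ ↦ Deligne1974_heckeT_eigenvalue_norm_le.weight_two hDel N p hp hpN μ hμ)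
    hMurty

end Literature.NumberTheory.EllipticCurves

end
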